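import Literature.Probability.RandomPlanarGeometry.SAWPolygonJoinSpec
import Literature.Probability.RandomPlanarGeometry.SAWPolygonGrowth
import Literature.Probability.RandomPlanarGeometry.SAWPolygonExtremalVertices

/-!
# Madras' polygon join on `ℤ²`: the join map `Ψ` and the inequality `√n · p_n² ≤ 2 · p_{2n+16}`

Topic `Literature/Probability/RandomPlanarGeometry` (continues `SAWPolygonJoinSpec.lean`: `CapHyp`, `CapSpec`, `CapGadget`,
`TallHalf`, `TallHeight`, `JoinIneq2`, `JoinMapSpec`, `Counting2`; `SAWPolygonJoinParity.lean`: `plaqFlip`, `IsEqJoinPlaquette`,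
`rayParity`, `rayParityHoriz`, `uniqueInteriorEqNeck`; `SAWWidePolygons.lean`: `normPolygons`, `normalise`, `IsNormal`;
`SAWPolygonSurgery.lean`: `IsPolygon.merge`).

Source.  N. Madras, J. Stat. Phys. 78 (1995) 681–699 [Madras1995LatticeAnimalsExponent] (the polygon bound
`p_n ≤ A n^{-1/2} μ^n`, `d = 2`, by joining pairs of polygons), in the form recalled by A. Hammond, arXiv:1504.05286
[Hammond2015SAPJoining], §4.1 pp. 17–18 of arXiv v5 (2017; all `[cite:]` pages below are v5 pages) ("Madras' polygon joining
procedure"): "shift `σ` to the left step by step until the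
first time at which there is a pair of vertices, one in `τ` and the other in the `σ`-translate, that share an `x`-coordinate and
whose `y`-coordinates differ by at most two … Denote by `Y` the vertex `z` with the maximal `y`-coordinate … no vertex of `τ`
belongs to the right corridor … Rotate `σ'` about the vertex `Y` by `π` radians … Translate `σ̃` to the right by `T₂` units,
where `T₂` equals five … six … seven … The polygon that Madras specifies as the join of `τ` and `σ` is given by
`(τ̃ ∪ (σ̃ + T₂ e₁)) Δ P¹`" (Definition 4.3, p. 20: `J(τ,σ) ∈ SAP_{n+m+16}`, `P¹` the junction plaquette; `τ̃`, `σ̃` are the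
printed `τ_mod`, `σ_mod`).

This file carries out steps S4+S5 of the lane's explicit-constant version (venture «pcv-sawmu», route MAD95-2JP): for every
`n`, the join map `Ψ(τ, σ, k) = normalise J(τ, σ + k e₂)` on the domain `D_n` = (tall `τ ∈ SAP_n`) × (`σ ∈ SAP_n`) × (rows
`k` of `τ`) lands in `SAP_{2n+16}` and is INJECTIVE, with `2·#D_n ≥ √n·p_n²`; whence `Counting2` (S1 + S2 + S3⁺ ⇒ S5⁺:
`√n·p_n² ≤ 2·p_{2n+16}`).  The cap rule is the abstract `CapGadget` (any `(cap, ext)` satisfying `CapSpec`); Madras'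
multiplicity argument is replaced by `uniqueInteriorEqNeck` (the junction cell is the unique equal-split join plaquette of
odd ray parity) — our decoding; all proofs are ours.

## Contents (namespace `Literature.Probability.RandomPlanarGeometry.SAW.JoinParity`; 0 sorries)

* translation / half-turn equivariance of `plaqFlip`, `IsEqJoinPlaquette`, `rayParity`, `CapHyp` (`htEdges`, …);
* the junction step `joinAt` (`isPolygon_joinAt`, `isEqJoinPlaquette_joinAt`, `plaqFlip_joinAt`);
* `pieces_unique` (a vertex-disjoint union of two polygons decomposes uniquely); ray-parity walks to infinity;
* rows of a polygon (`exists_vertex_row`, `sqrt_le_card_rows`) and the domain `joinDom` with `card_joinDom_ge`;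
* the slide `jStar`/`slid`, the contact site `Ysel`, `capHyp_tau`, `capHyp_rho`; the pieces `tauT`, `sigP`,
  `disjoint_pieces`; the raw join `Jraw` (`Jraw_isPolygon`, `Jraw_isEqJoin`, **`rayParity_Jraw`** `= 1`), `Psi_mem`;
* **`Psi_injOn`** (injectivity of `Ψ` on `D_n`), **`stub_joinMap : … → JoinMapSpec n`**, **`counting2 : Counting2`**.
-/

noncomputable section

open Filter Topology Finset SimpleGraph Literature.Probability.LatticeModels Literature.Probability.Percolation
open Literature.Barriers.CriticalPhenomena.SupercriticalSAW (shiftEdges isPolygon_shiftEdges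
  card_shiftEdges mem_shiftEdges_iff shiftEdges_injective)
open Literature.Probability.Percolation.SiteGadgetSystem (vertsOf mem_vertsOf)
open Literature.Probability.RandomPlanarGeometry.SAW

namespace Literature.Probability.RandomPlanarGeometry.SAW.JoinParity

/-! ### Coordinates on `ℤ²` -/

/-- two sites of `ℤ²` are equal iff their coordinates are. [folklore] -/
private theorem site_ext_iff (x y : Site 2) : x = y ↔ x 0 = y 0 ∧ x 1 = y 1 :=
  ⟨fun h => by rw [h]; exact ⟨rfl, rfl⟩, fun h => by funext i; fin_cases i <;> simp [h.1, h.2]⟩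

/-- `add_ex_zero`. [folklore] -/
@[simp] private theorem add_ex_zero (v : Site 2) : (v + ex) 0 = v 0 + 1 := by simp
/-- `add_ex_one`. [folklore] -/
@[simp] private theorem add_ex_one (v : Site 2) : (v + ex) 1 = v 1 := by simp
/-- `add_ey_zero`. [folklore] -/
@[simp] private theorem add_ey_zero (v : Site 2) : (v + ey) 0 = v 0 := by simp
/-- `add_ey_one`. [folklore] -/
@[simp] private theorem add_ey_one (v : Site 2) : (v + ey) 1 = v 1 + 1 := by simp
/-- `vec_zero'`. [folklore] -/
@[simp] private theorem vec_zero' (a b : ℤ) : (![a, b] : Site 2) 0 = a := rfl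
/-- `vec_one'`. [folklore] -/
@[simp] private theorem vec_one' (a b : ℤ) : (![a, b] : Site 2) 1 = b := rfl

open Classical in
/-- `rayParity` as the parity of a filter over `hEdge (c 0) k`, `k > c 1`. [folklore] -/
private theorem rayParity_eq_filter (E : Finset (Sym2 (Site 2))) (c : Site 2) : rayParity E c =
    ((E.filter (fun e => ∃ k : ℤ, c 1 < k ∧ e = hEdge (c 0) k)).card : ZMod 2) := by
  unfold rayParity hEdge; rfl

/-! ### Translation equivariance of the parity objects -/

/-- translation of an edge. [folklore] -/
abbrev shiftE (t : Site 2) (e : Sym2 (Site 2)) : Sym2 (Site 2) := Sym2.map (fun v => v + t) e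

/-- `shiftE_injective`. [folklore] -/
private theorem shiftE_injective (t : Site 2) : Function.Injective (shiftE t) :=
  Sym2.map.injective (add_left_injective t)

/-- a translated edge lies in the translated set iff the edge lies in the set. [folklore] -/
private theorem mem_shiftEdges {t : Site 2} {E : Finset (Sym2 (Site 2))} {e : Sym2 (Site 2)} :
    shiftE t e ∈ shiftEdges t E ↔ e ∈ E := by
  rw [mem_shiftEdges_iff]
  constructor
  · rintro ⟨e', he', h⟩; rwa [← shiftE_injective t h]
  · exact fun h => ⟨e, h, rfl⟩

/-- `shiftEdges_eq_image`. [folklore] -/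
private theorem shiftEdges_eq_image (t : Site 2) (E : Finset (Sym2 (Site 2))) : shiftEdges t E = E.image (shiftE t) := rfl

/-- `shiftE_plaqBot`. [folklore] -/
@[simp] private theorem shiftE_plaqBot (t v : Site 2) : shiftE t (plaqBot v) = plaqBot (v + t) := by
  simp only [shiftE, plaqBot, Sym2.map_mk]; congr 1; abel
/-- `shiftE_plaqTop`. [folklore] -/
@[simp] private theorem shiftE_plaqTop (t v : Site 2) : shiftE t (plaqTop v) = plaqTop (v + t) := by
  simp only [shiftE, plaqTop, Sym2.map_mk]; congr 1 <;> abel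
/-- `shiftE_plaqLeft`. [folklore] -/
@[simp] private theorem shiftE_plaqLeft (t v : Site 2) : shiftE t (plaqLeft v) = plaqLeft (v + t) := by
  simp only [shiftE, plaqLeft, Sym2.map_mk]; congr 1; abel
/-- `shiftE_plaqRight`. [folklore] -/
@[simp] private theorem shiftE_plaqRight (t v : Site 2) : shiftE t (plaqRight v) = plaqRight (v + t) := by
  simp only [shiftE, plaqRight, Sym2.map_mk]; congr 1 <;> abel

/-- `shiftE_hEdge`. [folklore] -/
private theorem shiftE_hEdge (t : Site 2) (a k : ℤ) : shiftE t (hEdge a k) = hEdge (a + t 0) (k + t 1) := by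
  simp only [shiftE, hEdge, Sym2.map_mk]
  congr 1 <;> (funext i; fin_cases i <;> simp [add_comm, add_assoc, add_left_comm])

/-- `plaqBot_mem_shiftEdges`. [folklore] -/
private theorem plaqBot_mem_shiftEdges {t v : Site 2} {E : Finset (Sym2 (Site 2))} :
    plaqBot (v + t) ∈ shiftEdges t E ↔ plaqBot v ∈ E := by rw [← shiftE_plaqBot, mem_shiftEdges]
/-- `plaqTop_mem_shiftEdges`. [folklore] -/
private theorem plaqTop_mem_shiftEdges {t v : Site 2} {E : Finset (Sym2 (Site 2))} :
    plaqTop (v + t) ∈ shiftEdges t E ↔ plaqTop v ∈ E := by rw [← shiftE_plaqTop, mem_shiftEdges]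
/-- `plaqLeft_mem_shiftEdges`. [folklore] -/
private theorem plaqLeft_mem_shiftEdges {t v : Site 2} {E : Finset (Sym2 (Site 2))} :
    plaqLeft (v + t) ∈ shiftEdges t E ↔ plaqLeft v ∈ E := by rw [← shiftE_plaqLeft, mem_shiftEdges]
/-- `plaqRight_mem_shiftEdges`. [folklore] -/
private theorem plaqRight_mem_shiftEdges {t v : Site 2} {E : Finset (Sym2 (Site 2))} :
    plaqRight (v + t) ∈ shiftEdges t E ↔ plaqRight v ∈ E := by rw [← shiftE_plaqRight, mem_shiftEdges]

/-- `shiftEdges_erase`. [folklore] -/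
private theorem shiftEdges_erase (t : Site 2) (E : Finset (Sym2 (Site 2))) (e : Sym2 (Site 2)) :
    shiftEdges t (E.erase e) = (shiftEdges t E).erase (shiftE t e) := by
  rw [shiftEdges_eq_image, shiftEdges_eq_image, Finset.image_erase (shiftE_injective t)]

/-- `shiftEdges_union`. [folklore] -/
private theorem shiftEdges_union (t : Site 2) (E F : Finset (Sym2 (Site 2))) :
    shiftEdges t (E ∪ F) = shiftEdges t E ∪ shiftEdges t F := by
  rw [shiftEdges_eq_image, shiftEdges_eq_image, shiftEdges_eq_image, Finset.image_union]

/-- `shiftEdges_insert`. [folklore] -/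
private theorem shiftEdges_insert (t : Site 2) (E : Finset (Sym2 (Site 2))) (e : Sym2 (Site 2)) :
    shiftEdges t (insert e E) = insert (shiftE t e) (shiftEdges t E) := by
  rw [shiftEdges_eq_image, shiftEdges_eq_image, Finset.image_insert]

/-- `shiftEdges_singleton`. [folklore] -/
private theorem shiftEdges_singleton (t : Site 2) (e : Sym2 (Site 2)) : shiftEdges t {e} = {shiftE t e} := by
  rw [shiftEdges_eq_image, Finset.image_singleton]

/-- the plaquette flip commutes with translations. [folklore] -/
private theorem plaqFlip_shiftEdges (t v : Site 2) (E : Finset (Sym2 (Site 2))) :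
    plaqFlip (shiftEdges t E) (v + t) = shiftEdges t (plaqFlip E v) := by
  rw [plaqFlip, plaqFlip, shiftEdges_union, shiftEdges_erase, shiftEdges_erase, shiftEdges_insert,
    shiftEdges_singleton, shiftE_plaqBot, shiftE_plaqTop, shiftE_plaqLeft, shiftE_plaqRight]

/-- the vertices of a translate are the translated vertices. [folklore] -/
private theorem vertsOf_shiftEdges (t : Site 2) (E : Finset (Sym2 (Site 2))) :
    vertsOf (shiftEdges t E) = (vertsOf E).image (fun v => v + t) := by
  ext v
  rw [mem_vertsOf_shiftEdges, Finset.mem_image]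
  constructor
  · exact fun h => ⟨v - t, h, sub_add_cancel v t⟩
  · rintro ⟨w, hw, rfl⟩; rwa [add_sub_cancel_right]

/-- `disjoint_vertsOf_shiftEdges`. [folklore] -/
private theorem disjoint_vertsOf_shiftEdges {t : Site 2} {E F : Finset (Sym2 (Site 2))} :
    Disjoint (vertsOf (shiftEdges t E)) (vertsOf (shiftEdges t F)) ↔ Disjoint (vertsOf E) (vertsOf F) := by
  rw [vertsOf_shiftEdges, vertsOf_shiftEdges, Finset.disjoint_image (add_left_injective t)]

/-- `shiftEdges_inj`. [folklore] -/
private theorem shiftEdges_inj {t : Site 2} {E F : Finset (Sym2 (Site 2))} : shiftEdges t E = shiftEdges t F ↔ E = F :=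
  (shiftEdges_injective t).eq_iff

/-- `shiftEdges_neg_shiftEdges`. [folklore] -/
private theorem shiftEdges_neg_shiftEdges (t : Site 2) (E : Finset (Sym2 (Site 2))) :
    shiftEdges (-t) (shiftEdges t E) = E := by
  rw [shiftEdges_shiftEdges, add_neg_cancel, shiftEdges_zero]

/-- `shiftEdges_shiftEdges_neg`. [folklore] -/
private theorem shiftEdges_shiftEdges_neg (t : Site 2) (E : Finset (Sym2 (Site 2))) :
    shiftEdges t (shiftEdges (-t) E) = E := by
  rw [shiftEdges_shiftEdges, neg_add_cancel, shiftEdges_zero]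

/-- `card_eq_of_shiftEdges`. [folklore] -/
private theorem card_eq_of_shiftEdges {t : Site 2} {E : Finset (Sym2 (Site 2))} : (shiftEdges t E).card = E.card :=
  card_shiftEdges t E

/-- `rayParity` is translation invariant. [folklore] -/
private theorem rayParity_shiftEdges (t c : Site 2) (E : Finset (Sym2 (Site 2))) :
    rayParity (shiftEdges t E) (c + t) = rayParity E c := by
  classical
  have hset : (shiftEdges t E).filter (fun e => ∃ k : ℤ, (c + t) 1 < k ∧ e = hEdge ((c + t) 0) k) =
      (E.filter (fun e => ∃ k : ℤ, c 1 < k ∧ e = hEdge (c 0) k)).image (shiftE t) := by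
    rw [shiftEdges_eq_image, Finset.filter_image]
    congr 1
    apply Finset.filter_congr
    intro e _
    simp only [Pi.add_apply]
    constructor
    · rintro ⟨k, hk, he⟩
      refine ⟨k - t 1, by linarith, shiftE_injective t ?_⟩
      rw [he, shiftE_hEdge, sub_add_cancel]
    · rintro ⟨k, hk, rfl⟩
      exact ⟨k + t 1, by linarith, by rw [shiftE_hEdge]⟩
  rw [rayParity_eq_filter, rayParity_eq_filter, hset, Finset.card_image_of_injective _ (shiftE_injective t)]

/-- `IsEqJoinPlaquette` is translation invariant. [folklore] -/
private theorem isEqJoinPlaquette_shiftEdges {t v : Site 2} {E : Finset (Sym2 (Site 2))} :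
    IsEqJoinPlaquette (shiftEdges t E) (v + t) ↔ IsEqJoinPlaquette E v := by
  unfold IsEqJoinPlaquette
  rw [plaqBot_mem_shiftEdges, plaqTop_mem_shiftEdges, plaqLeft_mem_shiftEdges, plaqRight_mem_shiftEdges,
    plaqFlip_shiftEdges]
  refine and_congr_right fun _ => and_congr_right fun _ => and_congr_right fun _ => and_congr_right fun _ => ?_
  constructor
  · rintro ⟨E₁, E₂, h₁, h₂, hd, hU, hc⟩
    refine ⟨shiftEdges (-t) E₁, shiftEdges (-t) E₂, isPolygon_shiftEdges h₁ _, isPolygon_shiftEdges h₂ _,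
      disjoint_vertsOf_shiftEdges.2 hd, ?_, by rw [card_shiftEdges, card_shiftEdges, hc]⟩
    rw [← shiftEdges_union, hU, shiftEdges_neg_shiftEdges]
  · rintro ⟨E₁, E₂, h₁, h₂, hd, hU, hc⟩
    refine ⟨shiftEdges t E₁, shiftEdges t E₂, isPolygon_shiftEdges h₁ _, isPolygon_shiftEdges h₂ _,
      disjoint_vertsOf_shiftEdges.2 hd, by rw [← shiftEdges_union, hU], by rw [card_shiftEdges, card_shiftEdges, hc]⟩

/-- `CapHyp` is translation invariant. [folklore] -/
private theorem capHyp_shiftEdges {t Y : Site 2} {τ : Finset (Sym2 (Site 2))} :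
    CapHyp (shiftEdges t τ) (Y + t) ↔ CapHyp τ Y := by
  unfold CapHyp
  simp only [vertsOf_shiftEdges, Finset.mem_image, Pi.add_apply, forall_exists_index, and_imp,
    forall_apply_eq_imp_iff₂]
  constructor
  · rintro ⟨⟨_, ⟨s, hs, rfl⟩, h0, h1⟩, h⟩
    refine ⟨⟨s, hs, by simpa using h0, by simpa using h1⟩, fun v hv hlt => ?_⟩
    have := h v hv (by simpa using hlt)
    simpa using this
  · rintro ⟨⟨s, hs, h0, h1⟩, h⟩
    refine ⟨⟨s + t, ⟨s, hs, rfl⟩, by simpa using h0, by simpa using h1⟩, fun v hv hlt => ?_⟩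
    have := h v hv (by simpa using hlt)
    simpa using this

/-! ### The half-turn about a site -/

/-- the half-turn (point reflection) of `ℤ²` about the site `Y`: `p ↦ 2Y − p`. [folklore] -/
def htSite (Y p : Site 2) : Site 2 := Y + Y - p

/-- `htSite_apply`. [folklore] -/
@[simp] private theorem htSite_apply (Y p : Site 2) (i : Fin 2) : htSite Y p i = Y i + Y i - p i := by
  simp [htSite]

/-- `htSite_htSite`. [folklore] -/
private theorem htSite_htSite (Y p : Site 2) : htSite Y (htSite Y p) = p := by
  unfold htSite; abel

/-- `htSite_injective`. [folklore] -/
private theorem htSite_injective (Y : Site 2) : Function.Injective (htSite Y) :=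
  Function.LeftInverse.injective (htSite_htSite Y)

/-- `htSite_add`. [folklore] -/
private theorem htSite_add (Y p t : Site 2) : htSite Y (p + t) = htSite Y p - t := by unfold htSite; abel

/-- `htSite_adj`. [folklore] -/
private theorem htSite_adj {Y v w : Site 2} (h : (zdGraph 2).Adj v w) : (zdGraph 2).Adj (htSite Y v) (htSite Y w) := by
  rw [zdGraph_adj_iff] at h ⊢
  obtain ⟨i, h | h⟩ := h
  · exact ⟨i, Or.inr (by rw [h]; unfold htSite; abel)⟩
  · exact ⟨i, Or.inl (by rw [h]; unfold htSite; abel)⟩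

/-- the half-turn as a graph homomorphism of `ℤ²`. [folklore] -/
def htHom (Y : Site 2) : zdGraph 2 →g zdGraph 2 where
  toFun := htSite Y
  map_rel' h := htSite_adj h

/-- half-turn of an edge. [folklore] -/
abbrev htE (Y : Site 2) (e : Sym2 (Site 2)) : Sym2 (Site 2) := Sym2.map (htSite Y) e

/-- `htE_injective`. [folklore] -/
private theorem htE_injective (Y : Site 2) : Function.Injective (htE Y) := Sym2.map.injective (htSite_injective Y)

/-- `htE_htE`. [folklore] -/
private theorem htE_htE (Y : Site 2) (e : Sym2 (Site 2)) : htE Y (htE Y e) = e := by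
  simp only [htE, Sym2.map_map]
  have : htSite Y ∘ htSite Y = id := funext (htSite_htSite Y)
  rw [this, Sym2.map_id, id]

/-- the half-turned edge set. [folklore] -/
def htEdges (Y : Site 2) (E : Finset (Sym2 (Site 2))) : Finset (Sym2 (Site 2)) := E.image (htE Y)

/-- `mem_htEdges`. [folklore] -/
private theorem mem_htEdges {Y : Site 2} {E : Finset (Sym2 (Site 2))} {e : Sym2 (Site 2)} :
    htE Y e ∈ htEdges Y E ↔ e ∈ E := by
  rw [htEdges, Finset.mem_image]
  constructor
  · rintro ⟨e', he', h⟩; rwa [← htE_injective Y h]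
  · exact fun h => ⟨e, h, rfl⟩

/-- `mem_htEdges_iff`. [folklore] -/
private theorem mem_htEdges_iff {Y : Site 2} {E : Finset (Sym2 (Site 2))} {e : Sym2 (Site 2)} :
    e ∈ htEdges Y E ↔ htE Y e ∈ E := by
  conv_lhs => rw [← htE_htE Y e]
  exact mem_htEdges

/-- `htEdges_htEdges`. [folklore] -/
private theorem htEdges_htEdges (Y : Site 2) (E : Finset (Sym2 (Site 2))) : htEdges Y (htEdges Y E) = E := by
  ext e; rw [mem_htEdges_iff, mem_htEdges_iff, htE_htE]

/-- `htEdges_injective`. [folklore] -/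
private theorem htEdges_injective (Y : Site 2) : Function.Injective (htEdges Y) :=
  Function.LeftInverse.injective (htEdges_htEdges Y)

/-- `card_htEdges`. [folklore] -/
private theorem card_htEdges (Y : Site 2) (E : Finset (Sym2 (Site 2))) : (htEdges Y E).card = E.card :=
  Finset.card_image_of_injective _ (htE_injective Y)

/-- the half-turn of a polygon is a polygon. [folklore] -/
private theorem isPolygon_htEdges {E : Finset (Sym2 (Site 2))} (hE : IsPolygon (zdGraph 2) E) (Y : Site 2) :
    IsPolygon (zdGraph 2) (htEdges Y E) := by
  classical
  obtain ⟨u, w, hw, rfl⟩ := hE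
  refine ⟨_, w.map (htHom Y), hw.map (htSite_injective Y), ?_⟩
  rw [Walk.edges_map]
  ext e
  simp only [List.mem_toFinset, List.mem_map, htEdges, Finset.mem_image]
  rfl

/-- the vertices of the half-turned set are the half-turned vertices. [folklore] -/
private theorem mem_vertsOf_htEdges {Y : Site 2} {E : Finset (Sym2 (Site 2))} {v : Site 2} :
    v ∈ vertsOf (htEdges Y E) ↔ htSite Y v ∈ vertsOf E := by
  simp only [mem_vertsOf, htEdges, Finset.mem_image]
  constructor
  · rintro ⟨e, ⟨e', he', rfl⟩, hv⟩
    refine ⟨e', he', ?_⟩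
    induction e' using Sym2.ind with
    | _ a b =>
      simp only [Sym2.map_mk, Sym2.mem_iff] at hv ⊢
      rcases hv with rfl | rfl
      · exact Or.inl (htSite_htSite Y a)
      · exact Or.inr (htSite_htSite Y b)
  · rintro ⟨e', he', hv⟩
    refine ⟨htE Y e', ⟨e', he', rfl⟩, ?_⟩
    induction e' using Sym2.ind with
    | _ a b =>
      simp only [Sym2.map_mk, Sym2.mem_iff] at hv ⊢
      rcases hv with h | h
      · exact Or.inl (by rw [← h, htSite_htSite])
      · exact Or.inr (by rw [← h, htSite_htSite])

/-- `vertsOf_htEdges`. [folklore] -/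
private theorem vertsOf_htEdges (Y : Site 2) (E : Finset (Sym2 (Site 2))) :
    vertsOf (htEdges Y E) = (vertsOf E).image (htSite Y) := by
  ext v
  rw [mem_vertsOf_htEdges, Finset.mem_image]
  constructor
  · exact fun h => ⟨htSite Y v, h, htSite_htSite Y v⟩
  · rintro ⟨w, hw, rfl⟩; rwa [htSite_htSite]

/-- half-turn of a translate = opposite translate of the half-turn. [folklore] -/
private theorem htEdges_shiftEdges (Y t : Site 2) (E : Finset (Sym2 (Site 2))) :
    htEdges Y (shiftEdges t E) = shiftEdges (-t) (htEdges Y E) := by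
  ext e
  rw [mem_htEdges_iff, mem_shiftEdges_iff, mem_shiftEdges_iff]
  constructor
  · rintro ⟨e', he', h⟩
    refine ⟨htE Y e', (mem_htEdges).2 he', ?_⟩
    have h2 := congrArg (htE Y) h
    rw [htE_htE] at h2
    rw [← h2]
    simp only [htE, Sym2.map_map]
    congr 1; funext v; simp only [Function.comp_apply]; rw [htSite_add]; abel
  · rintro ⟨e', he', rfl⟩
    rw [mem_htEdges_iff] at he'
    refine ⟨htE Y e', he', ?_⟩
    simp only [htE, Sym2.map_map]
    congr 1; funext v; simp only [Function.comp_apply]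
    rw [← sub_eq_add_neg, show v - t = v + (-t) from sub_eq_add_neg v t, htSite_add]; abel

/-! ### The join of two vertex-disjoint polygons across a plaquette (gen-3 toolkit) -/

/-- **The join across the plaquette `P(u)`**: drop the left side (in `E₁`) and the right side (in `E₂`),
add the bottom and top sides. [cite: Hammond2015SAPJoining, §4.1 p. 18 and Definition 4.3 p. 20 (the join across the junction plaquette P¹; arXiv v5)] -/
def joinAt (E₁ E₂ : Finset (Sym2 (Site 2))) (u : Site 2) : Finset (Sym2 (Site 2)) :=
  E₁.erase (plaqLeft u) ∪ E₂.erase (plaqRight u) ∪ ({plaqBot u} ∪ {plaqTop u})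

/-- `v ∼ v + e₂`. [folklore] -/
private theorem adj_add_ey' (v : Site 2) : (zdGraph 2).Adj v (v + ey) :=
  (zdGraph_adj_iff _ _).2 ⟨1, Or.inl (by funext i; fin_cases i <;> simp [ey])⟩

variable {E₁ E₂ : Finset (Sym2 (Site 2))} {u : Site 2}

/-- **The join is a polygon with `#E₁ + #E₂` edges** (vertex-disjoint pieces, facing vertical sides). [cite: Hammond2015SAPJoining, §4.1 p. 18 and Definition 4.3 p. 20 (the join across the junction plaquette P¹; arXiv v5)] -/
theorem isPolygon_joinAt (h₁ : IsPolygon (zdGraph 2) E₁) (h₂ : IsPolygon (zdGraph 2) E₂)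
    (hL : plaqLeft u ∈ E₁) (hR : plaqRight u ∈ E₂) (hdis : Disjoint (vertsOf E₁) (vertsOf E₂)) :
    IsPolygon (zdGraph 2) (joinAt E₁ E₂ u) ∧ (joinAt E₁ E₂ u).card = E₁.card + E₂.card := by
  classical
  -- the two unit rungs: bottom `u → u + ex`, top `u + ey → u + ey + ex`
  set R₁ : (zdGraph 2).Walk u (u + ex) := Walk.cons (adj_add_ex u) Walk.nil with hR₁
  set R₂ : (zdGraph 2).Walk (u + ey) (u + ey + ex) := Walk.cons (adj_add_ex (u + ey)) Walk.nil with hR₂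
  have hR₁p : R₁.IsPath := by simp [hR₁, Walk.cons_isPath_iff]; intro h; have := congrFun h 0; simp at this
  have hR₂p : R₂.IsPath := by simp [hR₂, Walk.cons_isPath_iff]; intro h; have := congrFun h 0; simp at this
  have hde : u + ex + ey = u + ey + ex := by abel
  have hcd : s(u + ex, u + ey + ex) ∈ E₂ := by rw [← hde]; exact hR
  -- vertex bookkeeping from disjointness
  have hV : ∀ x, (∃ e ∈ E₁, x ∈ e) → (∃ e ∈ E₂, x ∈ e) → False := fun x h1 h2 =>
    Finset.disjoint_left.1 hdis (mem_vertsOf.2 h1) (mem_vertsOf.2 h2)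
  have hu1 : u ∈ vertsOf E₁ := mem_vertsOf.2 ⟨_, hL, by simp [plaqLeft]⟩
  have huy1 : u + ey ∈ vertsOf E₁ := mem_vertsOf.2 ⟨_, hL, by simp [plaqLeft]⟩
  have hux2 : u + ex ∈ vertsOf E₂ := mem_vertsOf.2 ⟨_, hR, by simp [plaqRight]⟩
  have huxy2 : u + ex + ey ∈ vertsOf E₂ := mem_vertsOf.2 ⟨_, hR, by simp [plaqRight]⟩
  have n1 : ∀ {x}, x ∈ vertsOf E₂ → ¬ (∃ e ∈ E₁, x ∈ e) := fun {x} hx h =>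
    Finset.disjoint_left.1 hdis (mem_vertsOf.2 h) hx
  have n2 : ∀ {x}, x ∈ vertsOf E₁ → ¬ (∃ e ∈ E₂, x ∈ e) := fun {x} hx h =>
    Finset.disjoint_left.1 hdis hx (mem_vertsOf.2 h)
  have key := IsPolygon.merge h₁ h₂ hL hcd (R₁ := R₁) (R₂ := R₂) hR₁p hR₂p hV
    (fun x hx h1 => by
      simp only [hR₁, Walk.support_cons, Walk.support_nil, List.mem_cons, List.not_mem_nil, or_false] at hx
      rcases hx with rfl | rfl
      · rfl
      · exact absurd h1 (n1 hux2))
    (fun x hx h2 => by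
      simp only [hR₁, Walk.support_cons, Walk.support_nil, List.mem_cons, List.not_mem_nil, or_false] at hx
      rcases hx with rfl | rfl
      · exact absurd h2 (n2 hu1)
      · rfl)
    (fun x hx h1 => by
      simp only [hR₂, Walk.support_cons, Walk.support_nil, List.mem_cons, List.not_mem_nil, or_false] at hx
      rcases hx with rfl | rfl
      · rfl
      · rw [← hde] at h1; exact absurd h1 (n1 huxy2))
    (fun x hx h2 => by
      simp only [hR₂, Walk.support_cons, Walk.support_nil, List.mem_cons, List.not_mem_nil, or_false] at hx
      rcases hx with rfl | rfl
      · exact absurd h2 (n2 huy1)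
      · rfl)
    (fun x hx hx' => by
      simp only [hR₁, hR₂, Walk.support_cons, Walk.support_nil, List.mem_cons, List.not_mem_nil, or_false] at hx hx'
      rcases hx with rfl | rfl <;> rcases hx' with h | h
      · have h' := congrFun h 1; simp at h'
      · have h' := congrFun h 0; simp at h'
      · have h' := congrFun h 1; simp at h'
      · have h' := congrFun h 1; simp at h')
  have hedges : R₁.edges.toFinset ∪ R₂.edges.toFinset =
      ({plaqBot u} ∪ {plaqTop u} : Finset (Sym2 (Site 2))) := by
    simp [hR₁, hR₂, plaqBot, plaqTop]
  have hJ : joinAt E₁ E₂ u = E₁.erase s(u, u + ey) ∪ E₂.erase s(u + ex, u + ey + ex) ∪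
      (R₁.edges.toFinset ∪ R₂.edges.toFinset) := by
    rw [hedges, joinAt, plaqRight, plaqLeft, hde]
  obtain ⟨hpoly, hcard⟩ := key
  have hl1 : R₁.length = 1 := by simp [hR₁]
  have hl2 : R₂.length = 1 := by simp [hR₂]
  rw [hl1, hl2] at hcard
  rw [hJ]
  exact ⟨hpoly, by omega⟩


/-- The four sides of a plaquette are pairwise distinct edges. [cite: Hammond2015SAPJoining, §4.1 p. 18 and Definition 4.3 p. 20 (the join across the junction plaquette P¹; arXiv v5)] -/
private theorem plaq_sides_ne (u : Site 2) :
    plaqLeft u ≠ plaqBot u ∧ plaqLeft u ≠ plaqTop u ∧ plaqRight u ≠ plaqBot u ∧ plaqRight u ≠ plaqTop u ∧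
      plaqBot u ≠ plaqTop u ∧ plaqLeft u ≠ plaqRight u := by
  have a1 : u + ey ≠ u + ex := fun h => by have := congrFun h 0; simp at this
  have a2 : u + ey ≠ u := fun h => by have := congrFun h 1; simp at this
  have a3 : u + ex ≠ u := fun h => by have := congrFun h 0; simp at this
  have a4 : u ≠ u + ey + ex := fun h => by have := congrFun h 0; simp at this
  have a5 : u + ex ≠ u + ey := fun h => a1 h.symm
  have a6 : u + ex + ey ≠ u := fun h => by have := congrFun h 0; simp at this
  have a7 : u + ex ≠ u + ey + ex := fun h => by have := congrFun h 1; simp at this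
  have a8 : u ≠ u + ex := fun h => a3 h.symm
  have a9 : u ≠ u + ey := fun h => a2 h.symm
  simp only [plaqLeft, plaqBot, plaqTop, plaqRight, ne_eq, Sym2.eq_iff, not_or, not_and]
  refine ⟨⟨fun _ => a1, fun h => absurd h a8⟩, ⟨fun h => absurd h a9, fun h => absurd h a4⟩,
    ⟨fun h => absurd h a3, fun _ => a6⟩, ⟨fun h => absurd h a5, fun h => absurd h a7⟩,
    ⟨fun h => absurd h a9, fun h => absurd h a4⟩, ⟨fun h => absurd h a8, ?_⟩⟩
  intro h; have := congrFun h 0; simp at this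

/-- **`P(u)` is an equal-split join plaquette of the join** (when the two pieces have equal size). [cite: Hammond2015SAPJoining, §4.1 p. 18 and Definition 4.3 p. 20 (the join across the junction plaquette P¹; arXiv v5)] -/
theorem isEqJoinPlaquette_joinAt (h₁ : IsPolygon (zdGraph 2) E₁) (h₂ : IsPolygon (zdGraph 2) E₂)
    (hL : plaqLeft u ∈ E₁) (hR : plaqRight u ∈ E₂) (hdis : Disjoint (vertsOf E₁) (vertsOf E₂))
    (hcard : E₁.card = E₂.card) : IsEqJoinPlaquette (joinAt E₁ E₂ u) u := by
  classical
  have hu1 : u ∈ vertsOf E₁ := mem_vertsOf.2 ⟨_, hL, by simp [plaqLeft]⟩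
  have huy1 : u + ey ∈ vertsOf E₁ := mem_vertsOf.2 ⟨_, hL, by simp [plaqLeft]⟩
  have hux2 : u + ex ∈ vertsOf E₂ := mem_vertsOf.2 ⟨_, hR, by simp [plaqRight]⟩
  have huxy2 : u + ex + ey ∈ vertsOf E₂ := mem_vertsOf.2 ⟨_, hR, by simp [plaqRight]⟩
  have d12 : ∀ {x}, x ∈ vertsOf E₁ → x ∉ vertsOf E₂ := fun {x} h h' => Finset.disjoint_left.1 hdis h h'
  -- the horizontal sides are in neither piece; the vertical sides only in their own piece
  have hbot1 : plaqBot u ∉ E₁ := fun h => d12 (mem_vertsOf.2 ⟨_, h, by simp [plaqBot]⟩) hux2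
  have hbot2 : plaqBot u ∉ E₂ := fun h => d12 hu1 (mem_vertsOf.2 ⟨_, h, by simp [plaqBot]⟩)
  have htop1 : plaqTop u ∉ E₁ := fun h =>
    d12 (mem_vertsOf.2 ⟨_, h, by simp [plaqTop, show u + ey + ex = u + ex + ey by abel]⟩) huxy2
  have htop2 : plaqTop u ∉ E₂ := fun h => d12 huy1 (mem_vertsOf.2 ⟨_, h, by simp [plaqTop]⟩)
  have hleft2 : plaqLeft u ∉ E₂ := fun h => d12 hu1 (mem_vertsOf.2 ⟨_, h, by simp [plaqLeft]⟩)
  have hright1 : plaqRight u ∉ E₁ := fun h => d12 (mem_vertsOf.2 ⟨_, h, by simp [plaqRight]⟩) hux2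
  obtain ⟨nLB, nLT, nRB, nRT, nBT, nLR⟩ := plaq_sides_ne u
  refine ⟨?_, ?_, ?_, ?_, E₁, E₂, h₁, h₂, hdis, ?_, hcard⟩
  · simp [joinAt]
  · simp [joinAt]
  · simp only [joinAt, Finset.mem_union, Finset.mem_erase, Finset.mem_singleton]
    rintro ((⟨h, -⟩ | ⟨-, h⟩) | h | h)
    · exact h rfl
    · exact hleft2 h
    · exact nLB h
    · exact nLT h
  · simp only [joinAt, Finset.mem_union, Finset.mem_erase, Finset.mem_singleton]
    rintro ((⟨-, h⟩ | ⟨h, -⟩) | h | h)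
    · exact hright1 h
    · exact h rfl
    · exact nRB h
    · exact nRT h
  · -- `E₁ ∪ E₂ = plaqFlip (joinAt E₁ E₂ u) u`
    ext e
    simp only [plaqFlip, joinAt, Finset.mem_union, Finset.mem_erase, Finset.mem_singleton,
      Finset.mem_insert]
    constructor
    · intro he
      rcases he with he | he
      · by_cases h1 : e = plaqLeft u
        · exact Or.inr (Or.inl h1)
        · refine Or.inl ⟨fun h => htop1 (h ▸ he), fun h => hbot1 (h ▸ he), Or.inl (Or.inl ⟨h1, he⟩)⟩
      · by_cases h1 : e = plaqRight u
        · exact Or.inr (Or.inr h1)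
        · refine Or.inl ⟨fun h => htop2 (h ▸ he), fun h => hbot2 (h ▸ he), Or.inl (Or.inr ⟨h1, he⟩)⟩
    · intro he
      rcases he with ⟨hT, hB, (⟨-, he⟩ | ⟨-, he⟩) | hb | ht⟩ | rfl | rfl
      · exact Or.inl he
      · exact Or.inr he
      · exact (hB hb).elim
      · exact (hT ht).elim
      · exact Or.inl hL
      · exact Or.inr hR


/-- The flip of the join at its junction plaquette is the union of the two pieces. [cite: Hammond2015SAPJoining, §4.1 p. 18 and Definition 4.3 p. 20 (the join across the junction plaquette P¹; arXiv v5)] -/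
theorem plaqFlip_joinAt (hL : plaqLeft u ∈ E₁) (hR : plaqRight u ∈ E₂) (hdis : Disjoint (vertsOf E₁) (vertsOf E₂)) :
    plaqFlip (joinAt E₁ E₂ u) u = E₁ ∪ E₂ := by
  classical
  have hu1 : u ∈ vertsOf E₁ := mem_vertsOf.2 ⟨_, hL, by simp [plaqLeft]⟩
  have huy1 : u + ey ∈ vertsOf E₁ := mem_vertsOf.2 ⟨_, hL, by simp [plaqLeft]⟩
  have hux2 : u + ex ∈ vertsOf E₂ := mem_vertsOf.2 ⟨_, hR, by simp [plaqRight]⟩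
  have huxy2 : u + ex + ey ∈ vertsOf E₂ := mem_vertsOf.2 ⟨_, hR, by simp [plaqRight]⟩
  have d12 : ∀ {x}, x ∈ vertsOf E₁ → x ∉ vertsOf E₂ := fun {x} h h' => Finset.disjoint_left.1 hdis h h'
  have hbot1 : plaqBot u ∉ E₁ := fun h => d12 (mem_vertsOf.2 ⟨_, h, by simp [plaqBot]⟩) hux2
  have hbot2 : plaqBot u ∉ E₂ := fun h => d12 hu1 (mem_vertsOf.2 ⟨_, h, by simp [plaqBot]⟩)
  have htop1 : plaqTop u ∉ E₁ := fun h =>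
    d12 (mem_vertsOf.2 ⟨_, h, by simp [plaqTop, show u + ey + ex = u + ex + ey by abel]⟩) huxy2
  have htop2 : plaqTop u ∉ E₂ := fun h => d12 huy1 (mem_vertsOf.2 ⟨_, h, by simp [plaqTop]⟩)
  ext e
  simp only [plaqFlip, joinAt, Finset.mem_union, Finset.mem_erase, Finset.mem_singleton,
    Finset.mem_insert]
  constructor
  · intro he
    rcases he with ⟨hT, hB, (⟨-, he⟩ | ⟨-, he⟩) | hb | ht⟩ | rfl | rfl
    · exact Or.inl he
    · exact Or.inr he
    · exact (hB hb).elim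
    · exact (hT ht).elim
    · exact Or.inl hL
    · exact Or.inr hR
  · intro he
    rcases he with he | he
    · by_cases h1 : e = plaqLeft u
      · exact Or.inr (Or.inl h1)
      · refine Or.inl ⟨fun h => htop1 (h ▸ he), fun h => hbot1 (h ▸ he), Or.inl (Or.inl ⟨h1, he⟩)⟩
    · by_cases h1 : e = plaqRight u
      · exact Or.inr (Or.inr h1)
      · refine Or.inl ⟨fun h => htop2 (h ▸ he), fun h => hbot2 (h ▸ he), Or.inl (Or.inr ⟨h1, he⟩)⟩

/-- the bottom and top sides of the junction plaquette are edges of the join; its left and right sides are not. [cite: Hammond2015SAPJoining, §4.1 p. 18 and Definition 4.3 p. 20 (the join across the junction plaquette P¹; arXiv v5)] -/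
theorem sides_joinAt (hL : plaqLeft u ∈ E₁) (hR : plaqRight u ∈ E₂) (hdis : Disjoint (vertsOf E₁) (vertsOf E₂)) :
    plaqBot u ∈ joinAt E₁ E₂ u ∧ plaqTop u ∈ joinAt E₁ E₂ u ∧ plaqLeft u ∉ joinAt E₁ E₂ u ∧
      plaqRight u ∉ joinAt E₁ E₂ u := by
  classical
  have hu1 : u ∈ vertsOf E₁ := mem_vertsOf.2 ⟨_, hL, by simp [plaqLeft]⟩
  have hux2 : u + ex ∈ vertsOf E₂ := mem_vertsOf.2 ⟨_, hR, by simp [plaqRight]⟩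
  have d12 : ∀ {x}, x ∈ vertsOf E₁ → x ∉ vertsOf E₂ := fun {x} h h' => Finset.disjoint_left.1 hdis h h'
  have hleft2 : plaqLeft u ∉ E₂ := fun h => d12 hu1 (mem_vertsOf.2 ⟨_, h, by simp [plaqLeft]⟩)
  have hright1 : plaqRight u ∉ E₁ := fun h => d12 (mem_vertsOf.2 ⟨_, h, by simp [plaqRight]⟩) hux2
  obtain ⟨nLB, nLT, nRB, nRT, -, -⟩ := plaq_sides_ne u
  refine ⟨by simp [joinAt], by simp [joinAt], ?_, ?_⟩
  · simp only [joinAt, Finset.mem_union, Finset.mem_erase, Finset.mem_singleton]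
    rintro ((⟨h, -⟩ | ⟨-, h⟩) | h | h)
    · exact h rfl
    · exact hleft2 h
    · exact nLB h
    · exact nLT h
  · simp only [joinAt, Finset.mem_union, Finset.mem_erase, Finset.mem_singleton]
    rintro ((⟨-, h⟩ | ⟨h, -⟩) | h | h)
    · exact hright1 h
    · exact h rfl
    · exact nRB h
    · exact nRT h

/-! ### Unique decomposition of a vertex-disjoint union of two polygons -/

section Decomposition

variable {A B : Finset (Sym2 (Site 2))}

/-- Along a walk whose edges lie in `A ∪ B`, `A` and `B` having no common vertex, the edges are all in
`A` or all in `B`. [folklore] -/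
private theorem edges_subset_or (hd : Disjoint (vertsOf A) (vertsOf B)) :
    ∀ {x y : Site 2} (w : (zdGraph 2).Walk x y), (∀ e ∈ w.edges, e ∈ A ∪ B) →
      (∀ e ∈ w.edges, e ∈ A) ∨ (∀ e ∈ w.edges, e ∈ B)
  | _, _, Walk.nil => fun _ => Or.inl (by simp)
  | x, _, Walk.cons (v := y) h Walk.nil => fun hw => by
      have he : s(x, y) ∈ A ∪ B := hw _ (by simp)
      rcases Finset.mem_union.1 he with he | he
      · exact Or.inl (by simpa using he)
      · exact Or.inr (by simpa using he)
  | x, _, Walk.cons (v := y) h (Walk.cons (v := z) h' w) => fun hw => by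
      have hxy : s(x, y) ∈ A ∪ B := hw _ (by simp)
      have hw' : ∀ e ∈ (Walk.cons h' w).edges, e ∈ A ∪ B := fun e he => hw e (by simp_all)
      have ih := edges_subset_or hd (Walk.cons h' w) hw'
      have hyz : s(y, z) ∈ (Walk.cons h' w).edges := by simp
      have key : ∀ {C D : Finset (Sym2 (Site 2))}, Disjoint (vertsOf C) (vertsOf D) →
          s(x, y) ∈ C → s(y, z) ∈ D → False := fun hCD h1 h2 =>
        Finset.disjoint_left.1 hCD (mem_vertsOf.2 ⟨_, h1, Sym2.mem_mk_right _ _⟩)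
          (mem_vertsOf.2 ⟨_, h2, Sym2.mem_mk_left _ _⟩)
      rcases Finset.mem_union.1 hxy with hxy | hxy <;> rcases ih with ih | ih
      · refine Or.inl fun e he => ?_
        simp only [Walk.edges_cons, List.mem_cons] at he ih
        rcases he with rfl | he
        · exact hxy
        · exact ih e (by simpa using he)
      · exact (key hd hxy (ih _ hyz)).elim
      · exact (key hd.symm hxy (ih _ hyz)).elim
      · refine Or.inr fun e he => ?_
        simp only [Walk.edges_cons, List.mem_cons] at he ih
        rcases he with rfl | he
        · exact hxy
        · exact ih e (by simpa using he)

/-- A polygon inside `A ∪ B` (vertex-disjoint) meeting `A` lies inside `A`. [folklore] -/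
private theorem polygon_subset_of_mem (hd : Disjoint (vertsOf A) (vertsOf B)) {F : Finset (Sym2 (Site 2))}
    (hF : IsPolygon (zdGraph 2) F) (hsub : F ⊆ A ∪ B) {e : Sym2 (Site 2)} (he : e ∈ F) (heA : e ∈ A) :
    F ⊆ A := by
  classical
  obtain ⟨u, c, -, rfl⟩ := hF
  have hall : ∀ f ∈ c.edges, f ∈ A ∪ B := fun f hf => hsub (List.mem_toFinset.2 hf)
  rcases edges_subset_or hd c hall with h | h
  · intro f hf; exact h f (List.mem_toFinset.1 hf)
  · exfalso
    have heB : e ∈ B := h e (List.mem_toFinset.1 he)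
    induction e using Sym2.ind with
    | _ a b =>
      exact Finset.disjoint_left.1 hd (mem_vertsOf.2 ⟨_, heA, Sym2.mem_mk_left _ _⟩)
        (mem_vertsOf.2 ⟨_, heB, Sym2.mem_mk_left _ _⟩)

/-- An edge of `A` is not an edge of `B` when the two have no common vertex. [folklore] -/
private theorem not_mem_of_mem_of_disjoint (hd : Disjoint (vertsOf A) (vertsOf B)) {e : Sym2 (Site 2)} (he : e ∈ A) :
    e ∉ B := by
  intro heB
  induction e using Sym2.ind with
  | _ a b =>
    exact Finset.disjoint_left.1 hd (mem_vertsOf.2 ⟨_, he, Sym2.mem_mk_left _ _⟩)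
      (mem_vertsOf.2 ⟨_, heB, Sym2.mem_mk_left _ _⟩)

/-- `disjoint_of_disjoint_vertsOf`. [folklore] -/
private theorem disjoint_of_disjoint_vertsOf (hd : Disjoint (vertsOf A) (vertsOf B)) : Disjoint A B :=
  Finset.disjoint_left.2 fun _ he => not_mem_of_mem_of_disjoint hd he

/-- A polygon has an edge. [folklore] -/
private theorem polygon_nonempty {F : Finset (Sym2 (Site 2))} (hF : IsPolygon (zdGraph 2) F) : F.Nonempty := by
  obtain ⟨u, c, hc, rfl⟩ := hF
  have h3 := hc.three_le_length
  rw [← Walk.length_edges] at h3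
  obtain ⟨e, he⟩ := List.exists_mem_of_ne_nil c.edges (by intro h; rw [h] at h3; simp at h3)
  exact ⟨e, List.mem_toFinset.2 he⟩

/-- **Unique decomposition**: if `A ⊔ B = A' ⊔ B'` with all four polygons, both pairs vertex-disjoint, and
`A`, `A'` share an edge, then `A = A'` and `B = B'`. [folklore] -/
private theorem pieces_unique {A' B' : Finset (Sym2 (Site 2))} (hA : IsPolygon (zdGraph 2) A) (hB : IsPolygon (zdGraph 2) B)
    (hA' : IsPolygon (zdGraph 2) A') (hB' : IsPolygon (zdGraph 2) B')
    (hd : Disjoint (vertsOf A) (vertsOf B)) (hd' : Disjoint (vertsOf A') (vertsOf B'))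
    (hU : A ∪ B = A' ∪ B') {e : Sym2 (Site 2)} (he : e ∈ A) (he' : e ∈ A') : A = A' ∧ B = B' := by
  have h1 : A' ⊆ A := polygon_subset_of_mem hd hA' (hU ▸ Finset.subset_union_left) he' he
  have h2 : A ⊆ A' := polygon_subset_of_mem hd' hA (hU.symm ▸ Finset.subset_union_left) he he'
  have hAA' : A = A' := Finset.Subset.antisymm h2 h1
  refine ⟨hAA', ?_⟩
  obtain ⟨f, hf⟩ := polygon_nonempty hB
  have hfA : f ∉ A := not_mem_of_mem_of_disjoint hd.symm hf
  have hfB' : f ∈ B' := by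
    have : f ∈ A' ∪ B' := hU ▸ Finset.mem_union_right _ hf
    rcases Finset.mem_union.1 this with h | h
    · exact (hfA (hAA' ▸ h)).elim
    · exact h
  have h3 : B ⊆ B' := polygon_subset_of_mem hd'.symm hB
    (by rw [Finset.union_comm, ← hU]; exact Finset.subset_union_right) hf hfB'
  have h4 : B' ⊆ B := polygon_subset_of_mem hd.symm hB'
    (by rw [Finset.union_comm, hU]; exact Finset.subset_union_right) hfB' hf
  exact Finset.Subset.antisymm h3 h4

end Decomposition

/-! ### Ray parity: algebra and the walk to infinity -/

open Classical in
/-- `rayParity_union_of_disjoint`. [folklore] -/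
private theorem rayParity_union_of_disjoint {A B : Finset (Sym2 (Site 2))} (h : Disjoint A B) (c : Site 2) :
    rayParity (A ∪ B) c = rayParity A c + rayParity B c := by
  rw [rayParity_eq_filter, rayParity_eq_filter, rayParity_eq_filter, Finset.filter_union,
    Finset.card_union_of_disjoint (Finset.disjoint_filter_filter h), Nat.cast_add]

/-- `hEdge_fst`. [folklore] -/
private theorem hEdge_fst (a k : ℤ) : (![a, k] : Site 2) ∈ (hEdge a k : Sym2 (Site 2)) := by
  unfold hEdge; exact Sym2.mem_mk_left _ _

/-- `hEdge_ne_vertical`. [folklore] -/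
private theorem hEdge_ne_vertical (a k : ℤ) (v : Site 2) : hEdge a k ≠ s(v, v + ey) := by
  intro h
  unfold hEdge at h
  rcases Sym2.eq_iff.1 h with ⟨h1, h2⟩ | ⟨h1, h2⟩
  · have e1 := congrFun h1 0; have e2 := congrFun h2 0; simp at e1 e2; omega
  · have e1 := congrFun h1 0; have e2 := congrFun h2 0; simp at e1 e2; omega

/-- `plaqLeft_ne_hEdge`. [folklore] -/
private theorem plaqLeft_ne_hEdge (u : Site 2) (a k : ℤ) : plaqLeft u ≠ hEdge a k :=
  fun h => hEdge_ne_vertical a k u h.symm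

/-- `plaqRight_ne_hEdge`. [folklore] -/
private theorem plaqRight_ne_hEdge (u : Site 2) (a k : ℤ) : plaqRight u ≠ hEdge a k :=
  fun h => hEdge_ne_vertical a k (u + ex) h.symm

open Classical in
/-- `rayParity_erase_of_ne`. [folklore] -/
private theorem rayParity_erase_of_ne {E : Finset (Sym2 (Site 2))} {e : Sym2 (Site 2)} (c : Site 2)
    (h : ∀ k : ℤ, e ≠ hEdge (c 0) k) : rayParity (E.erase e) c = rayParity E c := by
  rw [rayParity_eq_filter, rayParity_eq_filter]
  congr 2
  ext f
  simp only [Finset.mem_filter, Finset.mem_erase]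
  constructor
  · rintro ⟨⟨-, hf⟩, hk⟩; exact ⟨hf, hk⟩
  · rintro ⟨hf, k, hk, rfl⟩; exact ⟨⟨(h k).symm, hf⟩, k, hk, rfl⟩

/-- `rayParity_erase_plaqLeft`. [folklore] -/
private theorem rayParity_erase_plaqLeft (E : Finset (Sym2 (Site 2))) (u c : Site 2) :
    rayParity (E.erase (plaqLeft u)) c = rayParity E c :=
  rayParity_erase_of_ne c fun k => plaqLeft_ne_hEdge u (c 0) k

/-- `rayParity_erase_plaqRight`. [folklore] -/
private theorem rayParity_erase_plaqRight (E : Finset (Sym2 (Site 2))) (u c : Site 2) :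
    rayParity (E.erase (plaqRight u)) c = rayParity E c :=
  rayParity_erase_of_ne c fun k => plaqRight_ne_hEdge u (c 0) k

/-- `plaqTop_eq_hEdge`. [folklore] -/
private theorem plaqTop_eq_hEdge (u : Site 2) : plaqTop u = hEdge (u 0) (u 1 + 1) := by
  unfold plaqTop hEdge
  congr 1 <;> (funext i; fin_cases i <;> simp)

/-- `plaqBot_eq_hEdge`. [folklore] -/
private theorem plaqBot_eq_hEdge (u : Site 2) : plaqBot u = hEdge (u 0) (u 1) := by
  unfold plaqBot hEdge
  congr 1 <;> (funext i; fin_cases i <;> simp)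

/-- `hEdge_inj'`. [folklore] -/
private theorem hEdge_inj' {a k a' k' : ℤ} (h : hEdge a k = hEdge a' k') : a = a' ∧ k = k' := by
  unfold hEdge at h
  rcases Sym2.eq_iff.1 h with ⟨h1, _⟩ | ⟨h1, h2⟩
  · exact ⟨by simpa using congrFun h1 0, by simpa using congrFun h1 1⟩
  · have e1 := congrFun h1 0; have e2 := congrFun h2 0
    simp at e1 e2; omega

open Classical in
/-- the two horizontal sides of `P(u)` contribute `1` to the ray parity at the cell `u`. [folklore] -/
private theorem rayParity_bot_top (u : Site 2) : rayParity ({plaqBot u} ∪ {plaqTop u}) u = 1 := by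
  rw [rayParity_eq_filter]
  have : ({plaqBot u} ∪ {plaqTop u} : Finset (Sym2 (Site 2))).filter
      (fun e => ∃ k : ℤ, u 1 < k ∧ e = hEdge (u 0) k) = {plaqTop u} := by
    ext e
    simp only [Finset.mem_filter, Finset.mem_union, Finset.mem_singleton]
    constructor
    · rintro ⟨rfl | rfl, k, hk, he⟩
      · rw [plaqBot_eq_hEdge] at he
        have := (hEdge_inj' he).2; omega
      · rfl
    · rintro rfl
      exact ⟨Or.inr rfl, u 1 + 1, by omega, plaqTop_eq_hEdge u⟩
  rw [this, Finset.card_singleton, Nat.cast_one]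

open Classical in
/-- no vertex of `E` in column `c 0` ⇒ parity `0` at `c`. [folklore] -/
private theorem rayParity_eq_zero_of_column {E : Finset (Sym2 (Site 2))} {c : Site 2}
    (h : ∀ v ∈ vertsOf E, v 0 ≠ c 0) : rayParity E c = 0 := by
  rw [rayParity_eq_filter]
  have : E.filter (fun e => ∃ k : ℤ, c 1 < k ∧ e = hEdge (c 0) k) = ∅ := by
    apply Finset.filter_eq_empty_iff.2
    rintro e he ⟨k, -, rfl⟩
    exact h _ (mem_vertsOf.2 ⟨_, he, hEdge_fst (c 0) k⟩) rfl
  rw [this, Finset.card_empty, Nat.cast_zero]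

/-- the columns of the vertices of a finite edge set are bounded above. [folklore] -/
private theorem exists_col_lt (E : Finset (Sym2 (Site 2))) : ∃ M : ℤ, ∀ v ∈ vertsOf E, v 0 < M := by
  by_cases hne : (vertsOf E).Nonempty
  · obtain ⟨w, hw, hmax⟩ := Finset.exists_max_image (vertsOf E) (fun v => v 0) hne
    exact ⟨w 0 + 1, fun v hv => by have := hmax v hv; omega⟩
  · exact ⟨0, fun v hv => (hne ⟨v, hv⟩).elim⟩

/-- the columns of the vertices of a finite edge set are bounded below. [folklore] -/
private theorem exists_lt_col (E : Finset (Sym2 (Site 2))) : ∃ M : ℤ, ∀ v ∈ vertsOf E, M < v 0 := by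
  by_cases hne : (vertsOf E).Nonempty
  · obtain ⟨w, hw, hmin⟩ := Finset.exists_min_image (vertsOf E) (fun v => v 0) hne
    exact ⟨w 0 - 1, fun v hv => by have := hmin v hv; omega⟩
  · exact ⟨0, fun v hv => (hne ⟨v, hv⟩).elim⟩

/-- `cell_add_ex`. [folklore] -/
private theorem cell_add_ex (x y : ℤ) : (![x, y] : Site 2) + ex = ![x + 1, y] := by
  funext i; fin_cases i <;> simp

/-- `cell_add_ey`. [folklore] -/
private theorem cell_add_ey (x y : ℤ) : (![x, y] : Site 2) + ey = ![x, y + 1] := by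
  funext i; fin_cases i <;> simp

/-- `site_eta`. [folklore] -/
private theorem site_eta (c : Site 2) : c = ![c 0, c 1] := by
  funext i; fin_cases i <;> rfl

/-- **Walking right to infinity**: if no vertex of the polygon `E` lies strictly right of column `c 0` in the
two rows `c 1`, `c 1 + 1`, then the ray parity at `c` vanishes. [folklore] -/
private theorem rayParity_eq_zero_of_right (hD : RayParityHoriz) {E : Finset (Sym2 (Site 2))}
    (hE : IsPolygon (zdGraph 2) E) (c : Site 2)
    (h : ∀ v ∈ vertsOf E, v 1 = c 1 ∨ v 1 = c 1 + 1 → v 0 ≤ c 0) : rayParity E c = 0 := by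
  obtain ⟨M, hM⟩ := exists_col_lt E
  -- parity is constant along the cell row to the right of `c`
  have step : ∀ m : ℕ, rayParity E ![c 0 + m, c 1] = rayParity E c := by
    intro m
    induction m with
    | zero => rw [Nat.cast_zero, add_zero, ← site_eta c]
    | succ m ih =>
      have hm := hD E hE ![c 0 + m, c 1]
      rw [cell_add_ex] at hm
      have hnot : plaqRight (![c 0 + m, c 1] : Site 2) ∉ E := by
        intro hmem
        have hv : (![c 0 + m, c 1] : Site 2) + ex ∈ vertsOf E :=
          mem_vertsOf.2 ⟨_, hmem, by simp [plaqRight]⟩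
        have := h _ hv (Or.inl (by simp))
        simp at this
        omega
      rw [if_neg hnot, add_zero] at hm
      rw [← ih, ← hm]; congr 1; funext i; fin_cases i <;> simp; ring
  -- far to the right it is `0`
  obtain ⟨m, hm⟩ : ∃ m : ℕ, M ≤ c 0 + m := ⟨(M - c 0).toNat, by omega⟩
  rw [← step m]
  exact rayParity_eq_zero_of_column fun v hv hv0 => by have := hM v hv; simp at hv0; omega

/-- **Walking left to infinity**: if no vertex of the polygon `E` lies in a column `≤ c 0` in the two rows
`c 1`, `c 1 + 1`, then the ray parity at `c` vanishes. [folklore] -/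
private theorem rayParity_eq_zero_of_left (hD : RayParityHoriz) {E : Finset (Sym2 (Site 2))}
    (hE : IsPolygon (zdGraph 2) E) (c : Site 2)
    (h : ∀ v ∈ vertsOf E, v 1 = c 1 ∨ v 1 = c 1 + 1 → c 0 + 1 ≤ v 0) : rayParity E c = 0 := by
  obtain ⟨M, hM⟩ := exists_lt_col E
  have step : ∀ m : ℕ, rayParity E ![c 0 - m, c 1] = rayParity E c := by
    intro m
    induction m with
    | zero => rw [Nat.cast_zero, sub_zero, ← site_eta c]
    | succ m ih =>
      have hm := hD E hE ![c 0 - (m + 1 : ℕ), c 1]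
      rw [cell_add_ex] at hm
      have hnot : plaqRight (![c 0 - (m + 1 : ℕ), c 1] : Site 2) ∉ E := by
        intro hmem
        have hv : (![c 0 - (m + 1 : ℕ), c 1] : Site 2) + ex ∈ vertsOf E :=
          mem_vertsOf.2 ⟨_, hmem, by simp [plaqRight]⟩
        have := h _ hv (Or.inl (by simp))
        simp at this
        omega
      rw [if_neg hnot, add_zero] at hm
      rw [← hm, ← ih]; congr 1; funext i; fin_cases i <;> simp; omega
  obtain ⟨m, hm⟩ : ∃ m : ℕ, c 0 - m ≤ M := ⟨(c 0 - M).toNat, by omega⟩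
  rw [← step m]
  exact rayParity_eq_zero_of_column fun v hv hv0 => by have := hM v hv; simp at hv0; omega

/-! ### Rows of a polygon: the intermediate value property and the size of the shift range -/

/-- Along a lattice walk the second coordinate takes every value between those of its endpoints. [folklore] -/
private theorem exists_mem_support_row : ∀ {x y : Site 2} (p : (zdGraph 2).Walk x y) {m : ℤ},
    x 1 ≤ m → m ≤ y 1 → ∃ v ∈ p.support, v 1 = m
  | x, _, Walk.nil, m, h1, h2 => ⟨x, by simp, le_antisymm h1 h2⟩
  | x, y, Walk.cons (v := x') h p, m, h1, h2 => by
      by_cases hm : m = x 1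
      · exact ⟨x, by simp, hm.symm⟩
      · have hx' : x' 1 ≤ m := by
          have := Zd.abs_sub_le_one_of_adj h 1
          have h3 : x 1 < m := lt_of_le_of_ne h1 (Ne.symm hm)
          have h4 : x' 1 - x 1 ≤ 1 := by
            have := abs_le.1 this; linarith [this.1, this.2]
          linarith
        obtain ⟨v, hv, hv1⟩ := exists_mem_support_row p hx' h2
        exact ⟨v, by simp [hv], hv1⟩

/-- **Row IVT for polygons**: every row between two vertex rows of a polygon carries a vertex. [folklore] -/
private theorem exists_vertex_row {E : Finset (Sym2 (Site 2))} (hE : IsPolygon (zdGraph 2) E) {a b : Site 2}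
    (ha : a ∈ vertsOf E) (hb : b ∈ vertsOf E) {m : ℤ} (h1 : a 1 ≤ m) (h2 : m ≤ b 1) :
    ∃ v ∈ vertsOf E, v 1 = m := by
  classical
  obtain ⟨u, c, hc, rfl⟩ := hE
  have ha' := (mem_vertsOf_iff_mem_support hc).1 ha
  have hb' := (mem_vertsOf_iff_mem_support hc).1 hb
  set p : (zdGraph 2).Walk a b := (c.takeUntil a ha').reverse.append (c.takeUntil b hb') with hp
  obtain ⟨v, hv, hv1⟩ := exists_mem_support_row p h1 h2
  refine ⟨v, (mem_vertsOf_iff_mem_support hc).2 ?_, hv1⟩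
  rw [hp, Walk.mem_support_append_iff, Walk.support_reverse, List.mem_reverse] at hv
  rcases hv with hv | hv
  · exact c.support_takeUntil_subset_support ha' hv
  · exact c.support_takeUntil_subset_support hb' hv

/-- the set of rows occupied by the vertices of `τ` (the admissible vertical shifts of `σ`). [folklore] -/
def rows (τ : Finset (Sym2 (Site 2))) : Finset ℤ := (vertsOf τ).image (fun v => v 1)

/-- `mem_rows`. [folklore] -/
private theorem mem_rows {τ : Finset (Sym2 (Site 2))} {k : ℤ} : k ∈ rows τ ↔ ∃ v ∈ vertsOf τ, v 1 = k := by
  rw [rows, Finset.mem_image]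

/-- A polygon occupies at least `|a₁ − b₁| + 1` rows for any two of its vertices `a`, `b`. [folklore] -/
private theorem card_rows_ge {E : Finset (Sym2 (Site 2))} (hE : IsPolygon (zdGraph 2) E) {a b : Site 2}
    (ha : a ∈ vertsOf E) (hb : b ∈ vertsOf E) : |a 1 - b 1| + 1 ≤ ((rows E).card : ℤ) := by
  -- WLOG `a 1 ≤ b 1`
  wlog hab : a 1 ≤ b 1 generalizing a b
  · have := this hb ha (by omega)
    rwa [abs_sub_comm] at this
  have hsub : Finset.Icc (a 1) (b 1) ⊆ rows E := by
    intro m hm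
    rw [Finset.mem_Icc] at hm
    exact mem_rows.2 (exists_vertex_row hE ha hb hm.1 hm.2)
  have h1 := Finset.card_le_card hsub
  rw [Int.card_Icc] at h1
  rw [abs_of_nonpos (by omega)]
  omega

/-- the rows of a normal `n`-gon lie in `[0, n]`. [folklore] -/
private theorem rows_subset_Icc {n : ℕ} {τ : Finset (Sym2 (Site 2))} (hτ : τ ∈ normPolygons n) :
    rows τ ⊆ Finset.Icc (0 : ℤ) n := by
  intro k hk
  obtain ⟨v, hv, rfl⟩ := mem_rows.1 hk
  obtain ⟨hP, hc, hN⟩ := mem_normPolygons.1 hτ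
  have := coord_mem_Icc_of_isNormal hP hN hv 1
  rw [hc] at this
  exact Finset.mem_Icc.2 this

/-- **S1b in use**: a tall `n`-gon occupies at least `√n` rows. [folklore] -/
private theorem sqrt_le_card_rows (hS1b : TallHeight) {n : ℕ} {τ : Finset (Sym2 (Site 2))}
    (hτ : τ ∈ normPolygons n) (ht : IsTall τ) : Real.sqrt n ≤ ((rows τ).card : ℝ) := by
  obtain ⟨a, ha, b, hb, hsq⟩ := hS1b n τ hτ ht
  obtain ⟨hP, -, -⟩ := mem_normPolygons.1 hτ
  have hr := card_rows_ge hP ha hb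
  have h1 : |a 1 - b 1 + 1| ≤ |a 1 - b 1| + 1 := by
    have := abs_add_le (a 1 - b 1) 1; simpa using this
  have h2 : (a 1 - b 1 + 1) ^ 2 ≤ ((rows τ).card : ℤ) ^ 2 := by
    have h3 : |a 1 - b 1 + 1| ≤ ((rows τ).card : ℤ) := h1.trans hr
    nlinarith [abs_nonneg (a 1 - b 1 + 1), sq_abs (a 1 - b 1 + 1)]
  have h4 : (n : ℝ) ≤ ((rows τ).card : ℝ) ^ 2 := by
    have : (n : ℤ) ≤ ((rows τ).card : ℤ) ^ 2 := hsq.trans h2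
    exact_mod_cast this
  calc Real.sqrt n ≤ Real.sqrt (((rows τ).card : ℝ) ^ 2) := Real.sqrt_le_sqrt h4
    _ = ((rows τ).card : ℝ) := Real.sqrt_sq (by positivity)

/-! ### The domain `D_n` of the join map -/

/-- the index type of the domain: `((τ, σ), k)`. [cite: Hammond2015SAPJoining, §3.4, Step one, pp. 12–13 (Madras' counting: order n^{1/2} join locations; arXiv v5)] -/
abbrev JIdx : Type := Σ _ : Finset (Sym2 (Site 2)) × Finset (Sym2 (Site 2)), ℤ

open Classical in
/-- **`D_n`**: tall `τ ∈ SAP_n` × `σ ∈ SAP_n` × admissible vertical shifts `k ∈ rows τ`. [cite: Hammond2015SAPJoining, §3.4, Step one, pp. 12–13 (Madras' counting: order n^{1/2} join locations; arXiv v5)] -/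
def joinDom (n : ℕ) : Finset JIdx :=
  (((normPolygons n).filter IsTall) ×ˢ normPolygons n).sigma (fun x => rows x.1)

open Classical in
/-- membership in the domain `D_n`. [cite: Hammond2015SAPJoining, §3.4, Step one, pp. 12–13 (Madras' counting: order n^{1/2} join locations; arXiv v5)] -/
theorem mem_joinDom {n : ℕ} {x : JIdx} : x ∈ joinDom n ↔
    x.1.1 ∈ normPolygons n ∧ IsTall x.1.1 ∧ x.1.2 ∈ normPolygons n ∧ x.2 ∈ rows x.1.1 := by
  rw [joinDom, Finset.mem_sigma, Finset.mem_product, Finset.mem_filter]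
  tauto

open Classical in
/-- **`2·#D_n ≥ √n · p_n²`** (S1a `TallHalf` + S1b `TallHeight`). [cite: Hammond2015SAPJoining, §3.4, Step one, pp. 12–13 (Madras' counting: order n^{1/2} join locations; arXiv v5)] -/
theorem card_joinDom_ge (hS1a : TallHalf) (hS1b : TallHeight) (n : ℕ) :
    Real.sqrt n * ((normPolygons n).card : ℝ) ^ 2 ≤ 2 * ((joinDom n).card : ℝ) := by
  have hcard : ((joinDom n).card : ℝ) =
      ∑ x ∈ ((normPolygons n).filter IsTall) ×ˢ normPolygons n, ((rows x.1).card : ℝ) := by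
    rw [joinDom, Finset.card_sigma, Nat.cast_sum]
  have hge : ∑ _x ∈ ((normPolygons n).filter IsTall) ×ˢ normPolygons n, Real.sqrt n ≤
      ∑ x ∈ ((normPolygons n).filter IsTall) ×ˢ normPolygons n, ((rows x.1).card : ℝ) := by
    apply Finset.sum_le_sum
    intro x hx
    obtain ⟨hx1, -⟩ := Finset.mem_product.1 hx
    obtain ⟨hτ, ht⟩ := Finset.mem_filter.1 hx1
    exact sqrt_le_card_rows hS1b hτ ht
  rw [Finset.sum_const, Finset.card_product, nsmul_eq_mul, Nat.cast_mul] at hge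
  have hS' : ((normPolygons n).card : ℝ) ≤ 2 * (((normPolygons n).filter IsTall).card : ℝ) := by
    exact_mod_cast hS1a n
  have h0 : (0 : ℝ) ≤ Real.sqrt n * ((normPolygons n).card : ℝ) :=
    mul_nonneg (Real.sqrt_nonneg _) (Nat.cast_nonneg _)
  have h5 := mul_le_mul_of_nonneg_left hS' h0
  rw [hcard]
  calc Real.sqrt n * ((normPolygons n).card : ℝ) ^ 2
      = Real.sqrt n * ((normPolygons n).card : ℝ) * ((normPolygons n).card : ℝ) := by ring
    _ ≤ Real.sqrt n * ((normPolygons n).card : ℝ) * (2 * (((normPolygons n).filter IsTall).card : ℝ)) := h5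
    _ = 2 * ((((normPolygons n).filter IsTall).card : ℝ) * ((normPolygons n).card : ℝ) * Real.sqrt n) := by
        ring
    _ ≤ 2 * ∑ x ∈ ((normPolygons n).filter IsTall) ×ˢ normPolygons n, ((rows x.1).card : ℝ) := by
        linarith [hge]

/-! ### The slide (Madras): the leftmost-stopping horizontal position of `σ'` against `τ` -/

/-- horizontal translation vector `(j, 0)`. [cite: Hammond2015SAPJoining, §4.1 p. 17 (the slide σ' = σ + T₁e₁ and the vertex Y; arXiv v5)] -/
def xvec (j : ℤ) : Site 2 := ![j, 0]
/-- vertical translation vector `(0, k)`. [cite: Hammond2015SAPJoining, §4.1 p. 17 (the slide σ' = σ + T₁e₁ and the vertex Y; arXiv v5)] -/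
def yvec (k : ℤ) : Site 2 := ![0, k]

/-- `xvec_zero`. [cite: Hammond2015SAPJoining, §4.1 p. 17 (the slide σ' = σ + T₁e₁ and the vertex Y; arXiv v5)] -/
@[simp] private theorem xvec_zero (j : ℤ) : xvec j 0 = j := rfl
/-- `xvec_one`. [cite: Hammond2015SAPJoining, §4.1 p. 17 (the slide σ' = σ + T₁e₁ and the vertex Y; arXiv v5)] -/
@[simp] private theorem xvec_one (j : ℤ) : xvec j 1 = 0 := rfl
/-- `yvec_zero`. [cite: Hammond2015SAPJoining, §4.1 p. 17 (the slide σ' = σ + T₁e₁ and the vertex Y; arXiv v5)] -/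
@[simp] private theorem yvec_zero (k : ℤ) : yvec k 0 = 0 := rfl
/-- `yvec_one`. [cite: Hammond2015SAPJoining, §4.1 p. 17 (the slide σ' = σ + T₁e₁ and the vertex Y; arXiv v5)] -/
@[simp] private theorem yvec_one (k : ℤ) : yvec k 1 = k := rfl

/-- `xvec_add`. [cite: Hammond2015SAPJoining, §4.1 p. 17 (the slide σ' = σ + T₁e₁ and the vertex Y; arXiv v5)] -/
private theorem xvec_add (a b : ℤ) : xvec a + xvec b = xvec (a + b) := by
  funext i; fin_cases i <;> simp [xvec]

/-- `xvec_neg`. [cite: Hammond2015SAPJoining, §4.1 p. 17 (the slide σ' = σ + T₁e₁ and the vertex Y; arXiv v5)] -/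
private theorem xvec_neg (a : ℤ) : -xvec a = xvec (-a) := by
  funext i; fin_cases i <;> simp [xvec]

/-- the horizontal shifts `j` for which `σ' + (j,0)` has a vertex in the column of a vertex of `τ` at vertical
distance `≤ 2` ("a coincidence"). [cite: Hammond2015SAPJoining, §4.1 p. 17 (the slide σ' = σ + T₁e₁ and the vertex Y; arXiv v5)] -/
def coinSet (τ σ' : Finset (Sym2 (Site 2))) : Finset ℤ :=
  ((vertsOf τ ×ˢ vertsOf σ').filter (fun p => |p.1 1 - p.2 1| ≤ 2)).image (fun p => p.1 0 - p.2 0)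

/-- membership in the coincidence set. [cite: Hammond2015SAPJoining, §4.1 p. 17 (the slide σ' = σ + T₁e₁ and the vertex Y; arXiv v5)] -/
private theorem mem_coinSet {τ σ' : Finset (Sym2 (Site 2))} {j : ℤ} :
    j ∈ coinSet τ σ' ↔ ∃ t ∈ vertsOf τ, ∃ s ∈ vertsOf σ', |t 1 - s 1| ≤ 2 ∧ t 0 - s 0 = j := by
  simp only [coinSet, Finset.mem_image, Finset.mem_filter, Finset.mem_product, Prod.exists]
  constructor
  · rintro ⟨t, s, ⟨⟨ht, hs⟩, h⟩, hj⟩; exact ⟨t, ht, s, hs, h, hj⟩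
  · rintro ⟨t, ht, s, hs, h, hj⟩; exact ⟨t, s, ⟨⟨ht, hs⟩, h⟩, hj⟩

/-- **the slide position** `j*`: the LARGEST coincidence shift (`σ'` comes from the far right and stops at the
first coincidence). [cite: Hammond2015SAPJoining, §4.1 p. 17 (the slide σ' = σ + T₁e₁ and the vertex Y; arXiv v5)] -/
def jStar (τ σ' : Finset (Sym2 (Site 2))) : ℤ :=
  if h : (coinSet τ σ').Nonempty then (coinSet τ σ').max' h else 0

/-- `jStar_mem`. [cite: Hammond2015SAPJoining, §4.1 p. 17 (the slide σ' = σ + T₁e₁ and the vertex Y; arXiv v5)] -/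
private theorem jStar_mem {τ σ' : Finset (Sym2 (Site 2))} (h : (coinSet τ σ').Nonempty) : jStar τ σ' ∈ coinSet τ σ' := by
  rw [jStar, dif_pos h]; exact Finset.max'_mem _ h

/-- `le_jStar`. [cite: Hammond2015SAPJoining, §4.1 p. 17 (the slide σ' = σ + T₁e₁ and the vertex Y; arXiv v5)] -/
private theorem le_jStar {τ σ' : Finset (Sym2 (Site 2))} {j : ℤ} (hj : j ∈ coinSet τ σ') : j ≤ jStar τ σ' := by
  rw [jStar, dif_pos ⟨j, hj⟩]; exact Finset.le_max' _ _ hj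

/-- the slid copy `σ'' = σ' + (j*, 0)`. [cite: Hammond2015SAPJoining, §4.1 p. 17 (the slide σ' = σ + T₁e₁ and the vertex Y; arXiv v5)] -/
def slid (τ σ' : Finset (Sym2 (Site 2))) : Finset (Sym2 (Site 2)) := shiftEdges (xvec (jStar τ σ')) σ'

/-- `mem_vertsOf_slid`. [cite: Hammond2015SAPJoining, §4.1 p. 17 (the slide σ' = σ + T₁e₁ and the vertex Y; arXiv v5)] -/
private theorem mem_vertsOf_slid {τ σ' : Finset (Sym2 (Site 2))} {s : Site 2} :
    s ∈ vertsOf (slid τ σ') ↔ s - xvec (jStar τ σ') ∈ vertsOf σ' := mem_vertsOf_shiftEdges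

/-- at the slide position there IS a coincidence. [cite: Hammond2015SAPJoining, §4.1 p. 17 (the slide σ' = σ + T₁e₁ and the vertex Y; arXiv v5)] -/
theorem exists_coin_slid {τ σ' : Finset (Sym2 (Site 2))} (h : (coinSet τ σ').Nonempty) :
    ∃ t ∈ vertsOf τ, ∃ s ∈ vertsOf (slid τ σ'), t 0 = s 0 ∧ |t 1 - s 1| ≤ 2 := by
  obtain ⟨t, ht, s, hs, hts, hj⟩ := mem_coinSet.1 (jStar_mem h)
  refine ⟨t, ht, s + xvec (jStar τ σ'), add_mem_vertsOf_shiftEdges.2 hs, ?_, ?_⟩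
  · simp; omega
  · simpa using hts

/-- beyond the slide position there is NO coincidence: a vertex of `σ''` strictly left of the column of a
vertex of `τ` is at vertical distance `> 2` from it. [cite: Hammond2015SAPJoining, §4.1 p. 17 (the slide σ' = σ + T₁e₁ and the vertex Y; arXiv v5)] -/
theorem noCoin_slid {τ σ' : Finset (Sym2 (Site 2))} {t s : Site 2} (ht : t ∈ vertsOf τ)
    (hs : s ∈ vertsOf (slid τ σ')) (hlt : s 0 < t 0) : 2 < |t 1 - s 1| := by
  by_contra hle
  push Not at hle
  have hs' := mem_vertsOf_slid.1 hs
  have hmem : t 0 - (s - xvec (jStar τ σ')) 0 ∈ coinSet τ σ' :=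
    mem_coinSet.2 ⟨t, ht, _, hs', by simpa using hle, rfl⟩
  have := le_jStar hmem
  simp at this
  omega

/-- "the set `{z − e₂, z, z + e₂}` contains a vertex of `τ`": the column triple at `Y` meets `E`. [cite: Hammond2015SAPJoining, §4.1 p. 17 (the vertex Y; arXiv v5)] -/
def TripleMeets (E : Finset (Sym2 (Site 2))) (Y : Site 2) : Prop :=
  ∃ t ∈ vertsOf E, t 0 = Y 0 ∧ |t 1 - Y 1| ≤ 1

open Classical in
/-- **the contact site `Y`**: some site whose column triple meets both `τ` and `σ''` (a definite choice). [cite: Hammond2015SAPJoining, §4.1 p. 17 (the slide σ' = σ + T₁e₁ and the vertex Y; arXiv v5)] -/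
def Ysel (τ σ'' : Finset (Sym2 (Site 2))) : Site 2 :=
  if h : ∃ Y, TripleMeets τ Y ∧ TripleMeets σ'' Y then Classical.choose h else 0

open Classical in
/-- the chosen contact site has its column triple meeting both `τ` and `σ''`. [cite: Hammond2015SAPJoining, §4.1 p. 17 (the slide σ' = σ + T₁e₁ and the vertex Y; arXiv v5)] -/
theorem Ysel_spec {τ σ'' : Finset (Sym2 (Site 2))} (h : ∃ Y, TripleMeets τ Y ∧ TripleMeets σ'' Y) :
    TripleMeets τ (Ysel τ σ'') ∧ TripleMeets σ'' (Ysel τ σ'') := by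
  rw [Ysel, dif_pos h]; exact Classical.choose_spec h

/-- `exists_Y_of_coin`. [cite: Hammond2015SAPJoining, §4.1 p. 17 (the slide σ' = σ + T₁e₁ and the vertex Y; arXiv v5)] -/
private theorem exists_Y_of_coin {τ σ'' : Finset (Sym2 (Site 2))} {t s : Site 2} (ht : t ∈ vertsOf τ)
    (hs : s ∈ vertsOf σ'') (h0 : t 0 = s 0) (h1 : |t 1 - s 1| ≤ 2) :
    ∃ Y, TripleMeets τ Y ∧ TripleMeets σ'' Y := by
  have h1' := abs_le.1 h1
  rcases le_total (t 1) (s 1) with hle | hle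
  · refine ⟨![t 0, s 1 - 1], ⟨t, ht, by simp, ?_⟩, ⟨s, hs, by simp [h0], ?_⟩⟩
    · rw [abs_le]; simp; constructor <;> linarith
    · rw [abs_le]; simp
  · refine ⟨![t 0, t 1 - 1], ⟨t, ht, by simp, ?_⟩, ⟨s, hs, by simp [h0], ?_⟩⟩
    · rw [abs_le]; simp
    · rw [abs_le]; simp; constructor <;> linarith

/-- **CapHyp for `τ`** at the contact site: the right corridor of `τ` is empty (else the slide would have
stopped earlier). [cite: Hammond2015SAPJoining, §4.1 p. 17 (the slide σ' = σ + T₁e₁ and the vertex Y; arXiv v5)] -/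
theorem capHyp_tau {τ σ' : Finset (Sym2 (Site 2))} {Y : Site 2} (hτ : TripleMeets τ Y)
    (hσ : TripleMeets (slid τ σ') Y) : CapHyp τ Y := by
  refine ⟨hτ, fun v hv hlt => ?_⟩
  obtain ⟨s, hs, hs0, hs1⟩ := hσ
  by_contra hle
  push Not at hle
  have h2 := noCoin_slid hv hs (by omega)
  have : |v 1 - s 1| ≤ 2 := by
    rw [abs_le] at hle hs1 ⊢; constructor <;> linarith [hle.1, hle.2, hs1.1, hs1.2]
  omega

/-- **CapHyp for the half-turned `σ''`**: the LEFT corridor of `σ''` is empty. [cite: Hammond2015SAPJoining, §4.1 p. 17 (the slide σ' = σ + T₁e₁ and the vertex Y; arXiv v5)] -/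
theorem capHyp_rho {τ σ' : Finset (Sym2 (Site 2))} {Y : Site 2} (hτ : TripleMeets τ Y)
    (hσ : TripleMeets (slid τ σ') Y) : CapHyp (htEdges Y (slid τ σ')) Y := by
  obtain ⟨s, hs, hs0, hs1⟩ := hσ
  refine ⟨⟨htSite Y s, mem_vertsOf_htEdges.2 (by rwa [htSite_htSite]), by simp [hs0], ?_⟩, fun v hv hlt => ?_⟩
  · simp; rw [abs_le] at hs1 ⊢; constructor <;> linarith [hs1.1, hs1.2]
  · obtain ⟨t, ht, ht0, ht1⟩ := hτ
    have hv' := mem_vertsOf_htEdges.1 hv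
    by_contra hle
    push Not at hle
    have h2 := noCoin_slid ht hv' (by simp; omega)
    have : |t 1 - htSite Y v 1| ≤ 2 := by
      simp
      rw [abs_le] at hle ht1 ⊢; constructor <;> linarith [hle.1, hle.2, ht1.1, ht1.2]
    omega

/-! ### The construction for a domain point `x = ((τ, σ), k)` -/

section Construction

variable (cap : Finset (Sym2 (Site 2)) → Site 2 → Finset (Sym2 (Site 2)))
  (ext : Finset (Sym2 (Site 2)) → Site 2 → ℤ)

/-- `σ' = σ + (0, k)`: the vertical translate of `σ` by the admissible shift `k`. [cite: Hammond2015SAPJoining, §4.1 pp. 17–18 (τ̃ = τ_mod, σ̃ + T₂e₁) and Definition 4.3 p. 20 (arXiv v5)] -/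
def sigK (x : JIdx) : Finset (Sym2 (Site 2)) := shiftEdges (yvec x.2) x.1.2
/-- `σ'' = σ' + (j*, 0)`, the slid copy. [cite: Hammond2015SAPJoining, §4.1 pp. 17–18 (τ̃ = τ_mod, σ̃ + T₂e₁) and Definition 4.3 p. 20 (arXiv v5)] -/
def sigS (x : JIdx) : Finset (Sym2 (Site 2)) := slid x.1.1 (sigK x)
/-- the contact site `Y`. [cite: Hammond2015SAPJoining, §4.1 pp. 17–18 (τ̃ = τ_mod, σ̃ + T₂e₁) and Definition 4.3 p. 20 (arXiv v5)] -/
def Yx (x : JIdx) : Site 2 := Ysel x.1.1 (sigS x)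
/-- `ρ` = the half-turn of `σ''` about `Y` (so that the cap rule, which caps to the RIGHT, caps `σ''` to the left). [cite: Hammond2015SAPJoining, §4.1 pp. 17–18 (τ̃ = τ_mod, σ̃ + T₂e₁) and Definition 4.3 p. 20 (arXiv v5)] -/
def rho (x : JIdx) : Finset (Sym2 (Site 2)) := htEdges (Yx x) (sigS x)
/-- `τ̃ = cap τ Y`: the capped left piece. [cite: Hammond2015SAPJoining, §4.1 pp. 17–18 (τ̃ = τ_mod, σ̃ + T₂e₁) and Definition 4.3 p. 20 (arXiv v5)] -/
def tauT (x : JIdx) : Finset (Sym2 (Site 2)) := cap x.1.1 (Yx x)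
/-- `ρ̃ = cap ρ Y`: the cap of the half-turned right piece. [cite: Hammond2015SAPJoining, §4.1 pp. 17–18 (τ̃ = τ_mod, σ̃ + T₂e₁) and Definition 4.3 p. 20 (arXiv v5)] -/
def rhoT (x : JIdx) : Finset (Sym2 (Site 2)) := cap (rho x) (Yx x)
/-- `T₂ = ext_τ + ext_ρ + 1 ∈ {5,6,7}`: the horizontal shift of `σ̃` ("five … six … seven"). [cite: Hammond2015SAPJoining, §4.1 pp. 17–18 (τ̃ = τ_mod, σ̃ + T₂e₁) and Definition 4.3 p. 20 (arXiv v5)] -/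
def T2 (x : JIdx) : ℤ := ext x.1.1 (Yx x) + ext (rho x) (Yx x) + 1
/-- `σ̃⁺` = the half-turn of `ρ̃`, shifted right by `T₂`. [cite: Hammond2015SAPJoining, §4.1 pp. 17–18 (τ̃ = τ_mod, σ̃ + T₂e₁) and Definition 4.3 p. 20 (arXiv v5)] -/
def sigP (x : JIdx) : Finset (Sym2 (Site 2)) := shiftEdges (xvec (T2 ext x)) (htEdges (Yx x) (rhoT cap x))
/-- the junction cell `u = (Y₀ + ext_τ, Y₁)` (lower-left corner of `P¹`). [cite: Hammond2015SAPJoining, §4.1 pp. 17–18 (τ̃ = τ_mod, σ̃ + T₂e₁) and Definition 4.3 p. 20 (arXiv v5)] -/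
def uJ (x : JIdx) : Site 2 := ![Yx x 0 + ext x.1.1 (Yx x), Yx x 1]
/-- the raw join `J = (τ̃ ∪ σ̃⁺) Δ ∂P¹`. [cite: Hammond2015SAPJoining, §4.1 pp. 17–18 (τ̃ = τ_mod, σ̃ + T₂e₁) and Definition 4.3 p. 20 (arXiv v5)] -/
def Jraw (x : JIdx) : Finset (Sym2 (Site 2)) := joinAt (tauT cap x) (sigP cap ext x) (uJ ext x)
/-- **the join map** `Ψ(τ, σ, k) = normalise J`. [cite: Hammond2015SAPJoining, §4.1 pp. 17–18 (τ̃ = τ_mod, σ̃ + T₂e₁) and Definition 4.3 p. 20 (arXiv v5)] -/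
def Psi (x : JIdx) : Finset (Sym2 (Site 2)) := normalise (Jraw cap ext x)

variable {cap ext} {n : ℕ} {x : JIdx}

/-- `tau_mem`. [cite: Hammond2015SAPJoining, §4.1 pp. 17–18 (τ̃ = τ_mod, σ̃ + T₂e₁) and Definition 4.3 p. 20 (arXiv v5)] -/
private theorem tau_mem (hx : x ∈ joinDom n) : x.1.1 ∈ normPolygons n := (mem_joinDom.1 hx).1
/-- `sig_mem`. [cite: Hammond2015SAPJoining, §4.1 pp. 17–18 (τ̃ = τ_mod, σ̃ + T₂e₁) and Definition 4.3 p. 20 (arXiv v5)] -/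
private theorem sig_mem (hx : x ∈ joinDom n) : x.1.2 ∈ normPolygons n := (mem_joinDom.1 hx).2.2.1
/-- `tau_isPolygon`. [cite: Hammond2015SAPJoining, §4.1 pp. 17–18 (τ̃ = τ_mod, σ̃ + T₂e₁) and Definition 4.3 p. 20 (arXiv v5)] -/
private theorem tau_isPolygon (hx : x ∈ joinDom n) : IsPolygon (zdGraph 2) x.1.1 := (mem_normPolygons.1 (tau_mem hx)).1
/-- `tau_card`. [cite: Hammond2015SAPJoining, §4.1 pp. 17–18 (τ̃ = τ_mod, σ̃ + T₂e₁) and Definition 4.3 p. 20 (arXiv v5)] -/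
private theorem tau_card (hx : x ∈ joinDom n) : x.1.1.card = n := (mem_normPolygons.1 (tau_mem hx)).2.1
/-- `tau_isNormal`. [cite: Hammond2015SAPJoining, §4.1 pp. 17–18 (τ̃ = τ_mod, σ̃ + T₂e₁) and Definition 4.3 p. 20 (arXiv v5)] -/
private theorem tau_isNormal (hx : x ∈ joinDom n) : IsNormal x.1.1 := (mem_normPolygons.1 (tau_mem hx)).2.2
/-- `sig_isPolygon`. [cite: Hammond2015SAPJoining, §4.1 pp. 17–18 (τ̃ = τ_mod, σ̃ + T₂e₁) and Definition 4.3 p. 20 (arXiv v5)] -/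
private theorem sig_isPolygon (hx : x ∈ joinDom n) : IsPolygon (zdGraph 2) x.1.2 := (mem_normPolygons.1 (sig_mem hx)).1
/-- `sig_card`. [cite: Hammond2015SAPJoining, §4.1 pp. 17–18 (τ̃ = τ_mod, σ̃ + T₂e₁) and Definition 4.3 p. 20 (arXiv v5)] -/
private theorem sig_card (hx : x ∈ joinDom n) : x.1.2.card = n := (mem_normPolygons.1 (sig_mem hx)).2.1
/-- `sig_isNormal`. [cite: Hammond2015SAPJoining, §4.1 pp. 17–18 (τ̃ = τ_mod, σ̃ + T₂e₁) and Definition 4.3 p. 20 (arXiv v5)] -/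
private theorem sig_isNormal (hx : x ∈ joinDom n) : IsNormal x.1.2 := (mem_normPolygons.1 (sig_mem hx)).2.2

/-- `sigS_isPolygon`. [cite: Hammond2015SAPJoining, §4.1 pp. 17–18 (τ̃ = τ_mod, σ̃ + T₂e₁) and Definition 4.3 p. 20 (arXiv v5)] -/
private theorem sigS_isPolygon (hx : x ∈ joinDom n) : IsPolygon (zdGraph 2) (sigS x) :=
  isPolygon_shiftEdges (isPolygon_shiftEdges (sig_isPolygon hx) _) _
/-- `sigS_card`. [cite: Hammond2015SAPJoining, §4.1 pp. 17–18 (τ̃ = τ_mod, σ̃ + T₂e₁) and Definition 4.3 p. 20 (arXiv v5)] -/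
private theorem sigS_card (hx : x ∈ joinDom n) : (sigS x).card = n := by
  rw [sigS, slid, card_shiftEdges, sigK, card_shiftEdges, sig_card hx]
/-- `rho_isPolygon`. [cite: Hammond2015SAPJoining, §4.1 pp. 17–18 (τ̃ = τ_mod, σ̃ + T₂e₁) and Definition 4.3 p. 20 (arXiv v5)] -/
private theorem rho_isPolygon (hx : x ∈ joinDom n) : IsPolygon (zdGraph 2) (rho x) := isPolygon_htEdges (sigS_isPolygon hx) _
/-- `rho_card`. [cite: Hammond2015SAPJoining, §4.1 pp. 17–18 (τ̃ = τ_mod, σ̃ + T₂e₁) and Definition 4.3 p. 20 (arXiv v5)] -/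
private theorem rho_card (hx : x ∈ joinDom n) : (rho x).card = n := by rw [rho, card_htEdges, sigS_card hx]

/-- the coincidence set is nonempty for an admissible shift `k ∈ rows τ` (row `k` is shared). [cite: Hammond2015SAPJoining, §4.1 pp. 17–18 (τ̃ = τ_mod, σ̃ + T₂e₁) and Definition 4.3 p. 20 (arXiv v5)] -/
private theorem coinSet_nonempty (hx : x ∈ joinDom n) : (coinSet x.1.1 (sigK x)).Nonempty := by
  obtain ⟨-, -, -, hk⟩ := mem_joinDom.1 hx
  obtain ⟨t, ht, htk⟩ := mem_rows.1 hk
  obtain ⟨-, -, ⟨s, hs, hs1⟩⟩ := sig_isNormal hx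
  refine ⟨t 0 - (s + yvec x.2) 0, mem_coinSet.2 ⟨t, ht, s + yvec x.2, add_mem_vertsOf_shiftEdges.2 hs, ?_, rfl⟩⟩
  simp [hs1, htk]

/-- `Y_spec`. [cite: Hammond2015SAPJoining, §4.1 pp. 17–18 (τ̃ = τ_mod, σ̃ + T₂e₁) and Definition 4.3 p. 20 (arXiv v5)] -/
private theorem Y_spec (hx : x ∈ joinDom n) : TripleMeets x.1.1 (Yx x) ∧ TripleMeets (sigS x) (Yx x) := by
  obtain ⟨t, ht, s, hs, h0, h1⟩ := exists_coin_slid (coinSet_nonempty hx)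
  exact Ysel_spec (exists_Y_of_coin ht hs h0 h1)

/-- `capHyp_tauY`. [cite: Hammond2015SAPJoining, §4.1 pp. 17–18 (τ̃ = τ_mod, σ̃ + T₂e₁) and Definition 4.3 p. 20 (arXiv v5)] -/
private theorem capHyp_tauY (hx : x ∈ joinDom n) : CapHyp x.1.1 (Yx x) := capHyp_tau (Y_spec hx).1 (Y_spec hx).2
/-- `capHyp_rhoY`. [cite: Hammond2015SAPJoining, §4.1 pp. 17–18 (τ̃ = τ_mod, σ̃ + T₂e₁) and Definition 4.3 p. 20 (arXiv v5)] -/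
private theorem capHyp_rhoY (hx : x ∈ joinDom n) : CapHyp (rho x) (Yx x) := capHyp_rho (Y_spec hx).1 (Y_spec hx).2

/-- vertices of a capped polygon are old vertices or window vertices. [cite: Hammond2015SAPJoining, §4.1 pp. 17–18 (τ̃ = τ_mod, σ̃ + T₂e₁) and Definition 4.3 p. 20 (arXiv v5)] -/
private theorem verts_cap_or {C τ : Finset (Sym2 (Site 2))} {Y : Site 2}
    (h7 : ∀ e, (e ∈ C ↔ e ∈ τ) ∨ (∀ v ∈ (e : Sym2 (Site 2)).toFinset, Y 0 - 1 ≤ v 0 ∧ |v 1 - Y 1| ≤ 1))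
    {v : Site 2} (hv : v ∈ vertsOf C) : v ∈ vertsOf τ ∨ |v 1 - Y 1| ≤ 1 := by
  obtain ⟨e, he, hve⟩ := mem_vertsOf.1 hv
  rcases h7 e with h | h
  · exact Or.inl (mem_vertsOf.2 ⟨e, h.1 he, hve⟩)
  · exact Or.inr (h v (Sym2.mem_toFinset.2 hve)).2

/-- `mem_vertsOf_sigP`. [cite: Hammond2015SAPJoining, §4.1 pp. 17–18 (τ̃ = τ_mod, σ̃ + T₂e₁) and Definition 4.3 p. 20 (arXiv v5)] -/
private theorem mem_vertsOf_sigP {v : Site 2} :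
    v ∈ vertsOf (sigP cap ext x) ↔ htSite (Yx x) (v - xvec (T2 ext x)) ∈ vertsOf (rhoT cap x) := by
  rw [sigP, mem_vertsOf_shiftEdges, mem_vertsOf_htEdges]

section Spec
variable (hS : CapSpec cap ext)
include hS

/-- `tauT_spec`. [cite: Hammond2015SAPJoining, §4.1 pp. 17–18 (τ̃ = τ_mod, σ̃ + T₂e₁) and Definition 4.3 p. 20 (arXiv v5)] -/
private theorem tauT_spec (hx : x ∈ joinDom n) :
    IsPolygon (zdGraph 2) (tauT cap x) ∧ (tauT cap x).card = n + 8 ∧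
    (ext x.1.1 (Yx x) = 2 ∨ ext x.1.1 (Yx x) = 3) ∧
    s((![Yx x 0 + ext x.1.1 (Yx x), Yx x 1 - 1] : Site 2), ![Yx x 0 + ext x.1.1 (Yx x), Yx x 1]) ∈ tauT cap x ∧
    s((![Yx x 0 + ext x.1.1 (Yx x), Yx x 1] : Site 2), ![Yx x 0 + ext x.1.1 (Yx x), Yx x 1 + 1]) ∈ tauT cap x ∧
    (∀ v ∈ vertsOf (tauT cap x), |v 1 - Yx x 1| ≤ 1 → v 0 ≤ Yx x 0 + ext x.1.1 (Yx x)) ∧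
    (∀ e, (e ∈ tauT cap x ↔ e ∈ x.1.1) ∨
      (∀ v ∈ (e : Sym2 (Site 2)).toFinset, Yx x 0 - 1 ≤ v 0 ∧ |v 1 - Yx x 1| ≤ 1)) := by
  have h := hS.1 x.1.1 (Yx x) (tau_isPolygon hx) (capHyp_tauY hx)
  rw [tau_card hx] at h
  exact h

/-- `rhoT_spec`. [cite: Hammond2015SAPJoining, §4.1 pp. 17–18 (τ̃ = τ_mod, σ̃ + T₂e₁) and Definition 4.3 p. 20 (arXiv v5)] -/
private theorem rhoT_spec (hx : x ∈ joinDom n) :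
    IsPolygon (zdGraph 2) (rhoT cap x) ∧ (rhoT cap x).card = n + 8 ∧
    (ext (rho x) (Yx x) = 2 ∨ ext (rho x) (Yx x) = 3) ∧
    s((![Yx x 0 + ext (rho x) (Yx x), Yx x 1 - 1] : Site 2), ![Yx x 0 + ext (rho x) (Yx x), Yx x 1]) ∈ rhoT cap x ∧
    s((![Yx x 0 + ext (rho x) (Yx x), Yx x 1] : Site 2), ![Yx x 0 + ext (rho x) (Yx x), Yx x 1 + 1]) ∈ rhoT cap x ∧
    (∀ v ∈ vertsOf (rhoT cap x), |v 1 - Yx x 1| ≤ 1 → v 0 ≤ Yx x 0 + ext (rho x) (Yx x)) ∧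
    (∀ e, (e ∈ rhoT cap x ↔ e ∈ rho x) ∨
      (∀ v ∈ (e : Sym2 (Site 2)).toFinset, Yx x 0 - 1 ≤ v 0 ∧ |v 1 - Yx x 1| ≤ 1)) := by
  have h := hS.1 (rho x) (Yx x) (rho_isPolygon hx) (capHyp_rhoY hx)
  rw [rho_card hx] at h
  exact h

/-- `sigP_isPolygon`. [cite: Hammond2015SAPJoining, §4.1 pp. 17–18 (τ̃ = τ_mod, σ̃ + T₂e₁) and Definition 4.3 p. 20 (arXiv v5)] -/
private theorem sigP_isPolygon (hx : x ∈ joinDom n) : IsPolygon (zdGraph 2) (sigP cap ext x) :=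
  isPolygon_shiftEdges (isPolygon_htEdges (rhoT_spec hS hx).1 _) _

/-- `sigP_card`. [cite: Hammond2015SAPJoining, §4.1 pp. 17–18 (τ̃ = τ_mod, σ̃ + T₂e₁) and Definition 4.3 p. 20 (arXiv v5)] -/
private theorem sigP_card (hx : x ∈ joinDom n) : (sigP cap ext x).card = n + 8 := by
  rw [sigP, card_shiftEdges, card_htEdges, (rhoT_spec hS hx).2.1]

/-- the corridor clause for `σ̃⁺`: its corridor-row vertices lie in columns `≥ X + 1`. [cite: Hammond2015SAPJoining, §4.1 pp. 17–18 (τ̃ = τ_mod, σ̃ + T₂e₁) and Definition 4.3 p. 20 (arXiv v5)] -/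
private theorem sigP_corridor (hx : x ∈ joinDom n) {v : Site 2} (hv : v ∈ vertsOf (sigP cap ext x))
    (hrow : |v 1 - Yx x 1| ≤ 1) : Yx x 0 + ext x.1.1 (Yx x) + 1 ≤ v 0 := by
  have hw := (mem_vertsOf_sigP).1 hv
  have h6 := (rhoT_spec hS hx).2.2.2.2.2.1 _ hw
  simp [T2] at h6
  have : |Yx x 1 + Yx x 1 - v 1 - Yx x 1| ≤ 1 := by
    rw [abs_le] at hrow ⊢; constructor <;> linarith [hrow.1, hrow.2]
  have := h6 this
  linarith

/-- the window clause for `σ̃⁺`: its vertices outside the corridor rows are vertices of `σ'' + T₂`. [cite: Hammond2015SAPJoining, §4.1 pp. 17–18 (τ̃ = τ_mod, σ̃ + T₂e₁) and Definition 4.3 p. 20 (arXiv v5)] -/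
private theorem sigP_window (hx : x ∈ joinDom n) {v : Site 2} (hv : v ∈ vertsOf (sigP cap ext x)) :
    v - xvec (T2 ext x) ∈ vertsOf (sigS x) ∨ |v 1 - Yx x 1| ≤ 1 := by
  have hw := (mem_vertsOf_sigP).1 hv
  rcases verts_cap_or (rhoT_spec hS hx).2.2.2.2.2.2 hw with h | h
  · left
    rw [rho, mem_vertsOf_htEdges, htSite_htSite] at h
    exact h
  · right
    simp at h
    rw [abs_le] at h ⊢; constructor <;> linarith [h.1, h.2]

/-- the window clause for `τ̃`. [cite: Hammond2015SAPJoining, §4.1 pp. 17–18 (τ̃ = τ_mod, σ̃ + T₂e₁) and Definition 4.3 p. 20 (arXiv v5)] -/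
private theorem tauT_window (hx : x ∈ joinDom n) {v : Site 2} (hv : v ∈ vertsOf (tauT cap x)) :
    v ∈ vertsOf x.1.1 ∨ |v 1 - Yx x 1| ≤ 1 :=
  verts_cap_or (tauT_spec hS hx).2.2.2.2.2.2 hv

/-- the corridor clause for `τ̃`. [cite: Hammond2015SAPJoining, §4.1 pp. 17–18 (τ̃ = τ_mod, σ̃ + T₂e₁) and Definition 4.3 p. 20 (arXiv v5)] -/
private theorem tauT_corridor (hx : x ∈ joinDom n) {v : Site 2} (hv : v ∈ vertsOf (tauT cap x))
    (hrow : |v 1 - Yx x 1| ≤ 1) : v 0 ≤ Yx x 0 + ext x.1.1 (Yx x) :=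
  (tauT_spec hS hx).2.2.2.2.2.1 v hv hrow

/-- **the two capped pieces are vertex-disjoint.** [cite: Hammond2015SAPJoining, §4.1 pp. 17–18 (τ̃ = τ_mod, σ̃ + T₂e₁) and Definition 4.3 p. 20 (arXiv v5)] -/
theorem disjoint_pieces (hx : x ∈ joinDom n) : Disjoint (vertsOf (tauT cap x)) (vertsOf (sigP cap ext x)) := by
  rw [Finset.disjoint_left]
  intro p hp1 hp2
  by_cases hrow : |p 1 - Yx x 1| ≤ 1
  · have h1 := tauT_corridor hS hx hp1 hrow
    have h2 := sigP_corridor hS hx hp2 hrow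
    omega
  · have h1 : p ∈ vertsOf x.1.1 := (tauT_window hS hx hp1).resolve_right hrow
    have h2 : p - xvec (T2 ext x) ∈ vertsOf (sigS x) := (sigP_window hS hx hp2).resolve_right hrow
    have hT : 0 < T2 ext x := by
      have := (tauT_spec hS hx).2.2.1; have := (rhoT_spec hS hx).2.2.1; simp only [T2]; omega
    have := noCoin_slid h1 h2 (by simp; omega)
    simp at this

end Spec

end Construction

section JoinFacts

variable {cap : Finset (Sym2 (Site 2)) → Site 2 → Finset (Sym2 (Site 2))}
  {ext : Finset (Sym2 (Site 2)) → Site 2 → ℤ} {n : ℕ} {x : JIdx} (hS : CapSpec cap ext)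
include hS

omit hS in
/-- `uJ_zero`. [cite: Hammond2015SAPJoining, §4.1 pp. 17–18 (τ̃ = τ_mod, σ̃ + T₂e₁) and Definition 4.3 p. 20 (arXiv v5)] -/
@[simp] private theorem uJ_zero : uJ ext x 0 = Yx x 0 + ext x.1.1 (Yx x) := rfl
omit hS in
/-- `uJ_one`. [cite: Hammond2015SAPJoining, §4.1 pp. 17–18 (τ̃ = τ_mod, σ̃ + T₂e₁) and Definition 4.3 p. 20 (arXiv v5)] -/
@[simp] private theorem uJ_one : uJ ext x 1 = Yx x 1 := rfl

omit hS in
/-- `uJ_add_ey`. [cite: Hammond2015SAPJoining, §4.1 pp. 17–18 (τ̃ = τ_mod, σ̃ + T₂e₁) and Definition 4.3 p. 20 (arXiv v5)] -/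
private theorem uJ_add_ey : uJ ext x + ey = ![Yx x 0 + ext x.1.1 (Yx x), Yx x 1 + 1] :=
  (site_ext_iff _ _).2 ⟨by simp [Pi.add_apply], by simp [Pi.add_apply]⟩

omit hS in
/-- `uJ_add_ex`. [cite: Hammond2015SAPJoining, §4.1 pp. 17–18 (τ̃ = τ_mod, σ̃ + T₂e₁) and Definition 4.3 p. 20 (arXiv v5)] -/
private theorem uJ_add_ex : uJ ext x + ex = ![Yx x 0 + ext x.1.1 (Yx x) + 1, Yx x 1] :=
  (site_ext_iff _ _).2 ⟨by simp [Pi.add_apply], by simp [Pi.add_apply]⟩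

omit hS in
/-- `uJ_add_ex_add_ey`. [cite: Hammond2015SAPJoining, §4.1 pp. 17–18 (τ̃ = τ_mod, σ̃ + T₂e₁) and Definition 4.3 p. 20 (arXiv v5)] -/
private theorem uJ_add_ex_add_ey : uJ ext x + ex + ey = ![Yx x 0 + ext x.1.1 (Yx x) + 1, Yx x 1 + 1] :=
  (site_ext_iff _ _).2 ⟨by simp [Pi.add_apply], by simp [Pi.add_apply]⟩

/-- the left side of the junction cell is the upper unit of `τ̃`'s facing 2-segment. [cite: Hammond2015SAPJoining, §4.1 pp. 17–18 (τ̃ = τ_mod, σ̃ + T₂e₁) and Definition 4.3 p. 20 (arXiv v5)] -/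
private theorem plaqLeft_mem_tauT (hx : x ∈ joinDom n) : plaqLeft (uJ ext x) ∈ tauT cap x := by
  have h := (tauT_spec hS hx).2.2.2.2.1
  rw [plaqLeft, uJ_add_ey]
  exact h

/-- the right side of the junction cell is the (half-turned, shifted) upper... i.e. LOWER unit of `ρ̃`'s facing
2-segment. [cite: Hammond2015SAPJoining, §4.1 pp. 17–18 (τ̃ = τ_mod, σ̃ + T₂e₁) and Definition 4.3 p. 20 (arXiv v5)] -/
private theorem plaqRight_mem_sigP (hx : x ∈ joinDom n) : plaqRight (uJ ext x) ∈ sigP cap ext x := by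
  have h := (rhoT_spec hS hx).2.2.2.1
  rw [plaqRight, uJ_add_ex_add_ey, uJ_add_ex, sigP, mem_shiftEdges_iff]
  refine ⟨s((![Yx x 0 - ext (rho x) (Yx x), Yx x 1] : Site 2), ![Yx x 0 - ext (rho x) (Yx x), Yx x 1 + 1]), ?_, ?_⟩
  · rw [mem_htEdges_iff]
    simp only [htE, Sym2.map_mk]
    rw [Sym2.eq_swap]
    convert h using 1
    congr 1 <;> (funext i; fin_cases i <;> simp)
  · simp only [Sym2.map_mk, T2]
    congr 1 <;> (funext i; fin_cases i <;> simp [xvec]; ring)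

/-- **the raw join is a polygon with `2n + 16` edges.** [cite: Hammond2015SAPJoining, §4.1 pp. 17–18 (τ̃ = τ_mod, σ̃ + T₂e₁) and Definition 4.3 p. 20 (arXiv v5)] -/
theorem Jraw_isPolygon (hx : x ∈ joinDom n) :
    IsPolygon (zdGraph 2) (Jraw cap ext x) ∧ (Jraw cap ext x).card = 2 * n + 16 := by
  obtain ⟨h1, h2⟩ := isPolygon_joinAt (tauT_spec hS hx).1 (sigP_isPolygon hS hx) (plaqLeft_mem_tauT hS hx)
    (plaqRight_mem_sigP hS hx) (disjoint_pieces hS hx)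
  refine ⟨h1, ?_⟩
  rw [Jraw, h2, (tauT_spec hS hx).2.1, sigP_card hS hx]; ring

/-- the junction cell is an equal-split join plaquette of the raw join. [cite: Hammond2015SAPJoining, §4.1 pp. 17–18 (τ̃ = τ_mod, σ̃ + T₂e₁) and Definition 4.3 p. 20 (arXiv v5)] -/
theorem Jraw_isEqJoin (hx : x ∈ joinDom n) : IsEqJoinPlaquette (Jraw cap ext x) (uJ ext x) :=
  isEqJoinPlaquette_joinAt (tauT_spec hS hx).1 (sigP_isPolygon hS hx) (plaqLeft_mem_tauT hS hx)
    (plaqRight_mem_sigP hS hx) (disjoint_pieces hS hx) (by rw [(tauT_spec hS hx).2.1, sigP_card hS hx])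

/-- the flip of the raw join at its junction cell is `τ̃ ∪ σ̃⁺` ("`J Δ P¹` is comprised of two disjoint polygons"). [cite: Hammond2015SAPJoining, §4.1 pp. 17–18 (τ̃ = τ_mod, σ̃ + T₂e₁) and Definition 4.3 p. 20 (arXiv v5)] -/
theorem Jraw_flip (hx : x ∈ joinDom n) : plaqFlip (Jraw cap ext x) (uJ ext x) = tauT cap x ∪ sigP cap ext x :=
  plaqFlip_joinAt (plaqLeft_mem_tauT hS hx) (plaqRight_mem_sigP hS hx) (disjoint_pieces hS hx)

/-- `τ̃` has ray parity `0` at the junction cell (walk right along the empty corridor). [cite: Hammond2015SAPJoining, §4.1 pp. 17–18 (τ̃ = τ_mod, σ̃ + T₂e₁) and Definition 4.3 p. 20 (arXiv v5)] -/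
private theorem rayParity_tauT (hD : RayParityHoriz) (hx : x ∈ joinDom n) : rayParity (tauT cap x) (uJ ext x) = 0 := by
  apply rayParity_eq_zero_of_right hD (tauT_spec hS hx).1
  intro v hv hrow
  simp only [uJ_one, uJ_zero] at hrow ⊢
  apply tauT_corridor hS hx hv
  rw [abs_le]; constructor <;> omega

/-- `σ̃⁺` has ray parity `0` at the junction cell (walk left along the empty corridor). [cite: Hammond2015SAPJoining, §4.1 pp. 17–18 (τ̃ = τ_mod, σ̃ + T₂e₁) and Definition 4.3 p. 20 (arXiv v5)] -/
private theorem rayParity_sigP (hD : RayParityHoriz) (hx : x ∈ joinDom n) : rayParity (sigP cap ext x) (uJ ext x) = 0 := by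
  apply rayParity_eq_zero_of_left hD (sigP_isPolygon hS hx)
  intro v hv hrow
  simp only [uJ_one, uJ_zero] at hrow ⊢
  apply sigP_corridor hS hx hv
  rw [abs_le]; constructor <;> omega

/-- **S4⁺: the junction cell is an INTERIOR neck — `π_J(P¹) = 1`.** [cite: Hammond2015SAPJoining, §4.1 pp. 17–18 (τ̃ = τ_mod, σ̃ + T₂e₁) and Definition 4.3 p. 20 (arXiv v5)] -/
theorem rayParity_Jraw (hD : RayParityHoriz) (hx : x ∈ joinDom n) : rayParity (Jraw cap ext x) (uJ ext x) = 1 := by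
  have hdis := disjoint_pieces hS hx
  have hAB : Disjoint ((tauT cap x).erase (plaqLeft (uJ ext x))) ((sigP cap ext x).erase (plaqRight (uJ ext x))) :=
    Finset.disjoint_of_subset_left (Finset.erase_subset _ _)
      (Finset.disjoint_of_subset_right (Finset.erase_subset _ _) (disjoint_of_disjoint_vertsOf hdis))
  -- the horizontal sides of the junction cell are in neither piece
  have hbot1 : plaqBot (uJ ext x) ∉ tauT cap x := fun h => by
    have hv : uJ ext x + ex ∈ vertsOf (tauT cap x) := mem_vertsOf.2 ⟨_, h, by simp [plaqBot]⟩
    have := tauT_corridor hS hx hv (by simp)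
    simp at this
  have hbot2 : plaqBot (uJ ext x) ∉ sigP cap ext x := fun h => by
    have hv : uJ ext x ∈ vertsOf (sigP cap ext x) := mem_vertsOf.2 ⟨_, h, by simp [plaqBot]⟩
    have := sigP_corridor hS hx hv (by simp)
    simp at this
  have htop1 : plaqTop (uJ ext x) ∉ tauT cap x := fun h => by
    have hv : uJ ext x + ey + ex ∈ vertsOf (tauT cap x) := mem_vertsOf.2 ⟨_, h, by simp [plaqTop]⟩
    have := tauT_corridor hS hx hv (by simp)
    simp at this
  have htop2 : plaqTop (uJ ext x) ∉ sigP cap ext x := fun h => by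
    have hv : uJ ext x + ey ∈ vertsOf (sigP cap ext x) := mem_vertsOf.2 ⟨_, h, by simp [plaqTop]⟩
    have := sigP_corridor hS hx hv (by simp)
    simp at this
  have hC : Disjoint ((tauT cap x).erase (plaqLeft (uJ ext x)) ∪ (sigP cap ext x).erase (plaqRight (uJ ext x)))
      ({plaqBot (uJ ext x)} ∪ {plaqTop (uJ ext x)}) := by
    rw [Finset.disjoint_left]
    intro e he he'
    simp only [Finset.mem_union, Finset.mem_singleton, Finset.mem_erase] at he he'
    rcases he' with rfl | rfl
    · rcases he with ⟨-, h⟩ | ⟨-, h⟩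
      · exact hbot1 h
      · exact hbot2 h
    · rcases he with ⟨-, h⟩ | ⟨-, h⟩
      · exact htop1 h
      · exact htop2 h
  rw [Jraw, joinAt, rayParity_union_of_disjoint hC, rayParity_union_of_disjoint hAB, rayParity_erase_plaqLeft,
    rayParity_erase_plaqRight, rayParity_tauT hS hD hx, rayParity_sigP hS hD hx, rayParity_bot_top]
  norm_num

/-- **`Ψ(x) ∈ SAP_{2n+16}`.** [cite: Hammond2015SAPJoining, §4.1 pp. 17–18 (τ̃ = τ_mod, σ̃ + T₂e₁) and Definition 4.3 p. 20 (arXiv v5)] -/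
theorem Psi_mem (hx : x ∈ joinDom n) : Psi cap ext x ∈ normPolygons (2 * n + 16) := by
  obtain ⟨hP, hc⟩ := Jraw_isPolygon hS hx
  obtain ⟨e, he⟩ := polygon_nonempty hP
  have hne : (vertsOf (Jraw cap ext x)).Nonempty := by
    induction e using Sym2.ind with
    | _ a b => exact ⟨a, mem_vertsOf.2 ⟨_, he, Sym2.mem_mk_left _ _⟩⟩
  rw [Psi, mem_normPolygons, normalise_eq _ hne]
  exact ⟨isPolygon_shiftEdges hP _, by rw [card_shiftEdges, hc], by rw [← normalise_eq _ hne]; exact isNormal_normalise hne⟩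

end JoinFacts

/-! ### Injectivity of `Ψ` on `D_n` -/

/-- `htSite_center_add`. [cite: Madras1995LatticeAnimalsExponent, §2 (decoding the join); Hammond2015SAPJoining, §3.4, Step one, pp. 12–13 (arXiv v5)] -/
private theorem htSite_center_add (Y d q : Site 2) : htSite (Y + d) q = htSite Y q + (d + d) := by
  unfold htSite; abel

/-- moving the centre of the half-turn translates the image by twice the displacement. [cite: Madras1995LatticeAnimalsExponent, §2 (decoding the join); Hammond2015SAPJoining, §3.4, Step one, pp. 12–13 (arXiv v5)] -/
private theorem htEdges_center_add (Y d : Site 2) (E : Finset (Sym2 (Site 2))) :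
    htEdges (Y + d) E = shiftEdges (d + d) (htEdges Y E) := by
  rw [htEdges, htEdges, shiftEdges_eq_image, Finset.image_image]
  congr 1
  funext e
  simp only [Function.comp_apply, htE, shiftE, Sym2.map_map]
  congr 1
  funext q
  simp only [htSite_center_add]

/-- two edge sets with the same normalisation are translates of each other. [cite: Madras1995LatticeAnimalsExponent, §2 (decoding the join); Hammond2015SAPJoining, §3.4, Step one, pp. 12–13 (arXiv v5)] -/
private theorem exists_shift_of_normalise_eq {E F : Finset (Sym2 (Site 2))} (h : normalise E = normalise F) :
    ∃ s : Site 2, F = shiftEdges s E := by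
  obtain ⟨t, ht⟩ := exists_normalise_eq_shiftEdges E
  obtain ⟨t', ht'⟩ := exists_normalise_eq_shiftEdges F
  refine ⟨t + -t', ?_⟩
  rw [← shiftEdges_shiftEdges, ← ht, h, ht', shiftEdges_neg_shiftEdges]

/-- cancelling a translation on the left. [cite: Madras1995LatticeAnimalsExponent, §2 (decoding the join); Hammond2015SAPJoining, §3.4, Step one, pp. 12–13 (arXiv v5)] -/
private theorem shift_cancel_left {a b : Site 2} {E F : Finset (Sym2 (Site 2))} (h : shiftEdges a E = shiftEdges b F) :
    E = shiftEdges (b + -a) F := by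
  have := congrArg (shiftEdges (-a)) h
  rwa [shiftEdges_neg_shiftEdges, shiftEdges_shiftEdges] at this

section Injectivity

variable {cap : Finset (Sym2 (Site 2)) → Site 2 → Finset (Sym2 (Site 2))}
  {ext : Finset (Sym2 (Site 2)) → Site 2 → ℤ} {n : ℕ} {x x' : JIdx} (hS : CapSpec cap ext)
include hS

/-- Step 1: the junction cells correspond under the translation (UNIQUE INTERIOR NECK). [cite: Madras1995LatticeAnimalsExponent, §2 (decoding the join); Hammond2015SAPJoining, §3.4, Step one, pp. 12–13 (arXiv v5)] -/
theorem junction_shift (hU : UniqueInteriorEqNeck) (hD : RayParityHoriz) (hx : x ∈ joinDom n)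
    (hx' : x' ∈ joinDom n) {s : Site 2} (hJ : Jraw cap ext x' = shiftEdges s (Jraw cap ext x)) :
    uJ ext x' = uJ ext x + s := by
  by_contra hne
  have h1 : IsEqJoinPlaquette (Jraw cap ext x') (uJ ext x') := Jraw_isEqJoin hS hx'
  have h2 : IsEqJoinPlaquette (Jraw cap ext x') (uJ ext x + s) := by
    rw [hJ]; exact isEqJoinPlaquette_shiftEdges.2 (Jraw_isEqJoin hS hx)
  have p1 : rayParity (Jraw cap ext x') (uJ ext x') = 1 := rayParity_Jraw hS hD hx'
  have p2 : rayParity (Jraw cap ext x') (uJ ext x + s) = 1 := by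
    rw [hJ, rayParity_shiftEdges]; exact rayParity_Jraw hS hD hx
  exact hU _ (Jraw_isPolygon hS hx').1 _ _ hne h1 h2 p1 p2

/-- Step 2: the pieces correspond under the translation (unique decomposition of the flip). [cite: Madras1995LatticeAnimalsExponent, §2 (decoding the join); Hammond2015SAPJoining, §3.4, Step one, pp. 12–13 (arXiv v5)] -/
theorem pieces_shift (hx : x ∈ joinDom n) (hx' : x' ∈ joinDom n) {s : Site 2}
    (hJ : Jraw cap ext x' = shiftEdges s (Jraw cap ext x)) (hu : uJ ext x' = uJ ext x + s) :
    tauT cap x' = shiftEdges s (tauT cap x) ∧ sigP cap ext x' = shiftEdges s (sigP cap ext x) := by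
  have hflip' := Jraw_flip hS hx'
  have hflip : plaqFlip (Jraw cap ext x') (uJ ext x') = shiftEdges s (tauT cap x) ∪ shiftEdges s (sigP cap ext x) := by
    rw [hu, hJ, plaqFlip_shiftEdges, Jraw_flip hS hx, shiftEdges_union]
  have hU : shiftEdges s (tauT cap x) ∪ shiftEdges s (sigP cap ext x) = tauT cap x' ∪ sigP cap ext x' := by
    rw [← hflip, hflip']
  have key := pieces_unique (isPolygon_shiftEdges (tauT_spec hS hx).1 s) (isPolygon_shiftEdges (sigP_isPolygon hS hx) s)
    (tauT_spec hS hx').1 (sigP_isPolygon hS hx') (disjoint_vertsOf_shiftEdges.2 (disjoint_pieces hS hx))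
    (disjoint_pieces hS hx') hU (e := plaqLeft (uJ ext x'))
    (by rw [hu]; exact plaqLeft_mem_shiftEdges.2 (plaqLeft_mem_tauT hS hx)) (plaqLeft_mem_tauT hS hx')
  exact ⟨key.1.symm, key.2.symm⟩

/-- Step 3: `τ' = τ + s` (cap injectivity + equivariance), hence `s = 0` (both normal). [cite: Madras1995LatticeAnimalsExponent, §2 (decoding the join); Hammond2015SAPJoining, §3.4, Step one, pp. 12–13 (arXiv v5)] -/
theorem shift_eq_zero (hx : x ∈ joinDom n) (hx' : x' ∈ joinDom n) {s : Site 2}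
    (hu : uJ ext x' = uJ ext x + s) (hτ : tauT cap x' = shiftEdges s (tauT cap x)) : s = 0 := by
  obtain ⟨-, hinj, heqv⟩ := hS
  have hP := tau_isPolygon hx
  have hC := capHyp_tauY hx
  obtain ⟨hcap, hext⟩ := heqv x.1.1 (Yx x) s hP hC
  have hrow : Yx x' 1 = (Yx x + s) 1 := by
    have := congrFun hu 1; simpa using this
  have hcol : Yx x' 0 + ext x'.1.1 (Yx x') = (Yx x + s) 0 + ext (shiftEdges s x.1.1) (Yx x + s) := by
    have := congrFun hu 0; simp at this; rw [hext]; simp; linarith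
  have hlit : cap x'.1.1 (Yx x') = cap (shiftEdges s x.1.1) (Yx x + s) := by
    rw [hcap]; exact hτ
  have hτ' : x'.1.1 = shiftEdges s x.1.1 :=
    hinj x'.1.1 (shiftEdges s x.1.1) (Yx x') (Yx x + s) (tau_isPolygon hx') (capHyp_tauY hx')
      (isPolygon_shiftEdges hP s) (capHyp_shiftEdges.2 hC) hrow hcol hlit
  have h1 : IsNormal (shiftEdges s x.1.1) := hτ' ▸ tau_isNormal hx'
  have h0 : IsNormal (shiftEdges 0 x.1.1) := by rw [shiftEdges_zero]; exact tau_isNormal hx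
  exact shift_eq_of_isNormal h1 h0

/-- Step 4: with `s = 0`: `σ` and `k` are recovered (cap injectivity + equivariance on the half-turned side). [cite: Madras1995LatticeAnimalsExponent, §2 (decoding the join); Hammond2015SAPJoining, §3.4, Step one, pp. 12–13 (arXiv v5)] -/
theorem sigma_eq (hx : x ∈ joinDom n) (hx' : x' ∈ joinDom n) (hτ : x'.1.1 = x.1.1)
    (hu : uJ ext x' = uJ ext x) (hσ : sigP cap ext x' = sigP cap ext x) : x'.1.2 = x.1.2 ∧ x'.2 = x.2 := by
  obtain ⟨-, hinj, heqv⟩ := hS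
  -- notation
  set Y := Yx x with hY
  set Y' := Yx x' with hY'
  set e := ext x.1.1 Y with he
  set e' := ext x'.1.1 Y' with he'
  set r := ext (rho x) Y with hr
  set r' := ext (rho x') Y' with hr'
  set d := Y' - Y with hd
  have hYd : Y' = Y + d := by rw [hd]; abel
  have hrow : Y' 1 = Y 1 := by have := congrFun hu 1; simpa using this
  have hcol : Y' 0 + e' = Y 0 + e := by have := congrFun hu 0; simpa using this
  have hd1 : d 1 = 0 := by simp [hd, hrow]
  have hd0 : d 0 = Y' 0 - Y 0 := by simp [hd]
  -- unshift and un-turn the equality of the `σ̃⁺`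
  have h1 : htEdges Y (rhoT cap x) = shiftEdges (xvec (T2 ext x') + -xvec (T2 ext x)) (htEdges Y' (rhoT cap x')) := by
    have := congrArg (shiftEdges (-xvec (T2 ext x))) hσ
    rw [sigP, sigP, shiftEdges_neg_shiftEdges, shiftEdges_shiftEdges] at this
    exact this.symm
  rw [hYd, htEdges_center_add, shiftEdges_shiftEdges] at h1
  have h2 := congrArg (htEdges Y) h1
  rw [htEdges_htEdges, htEdges_shiftEdges, htEdges_htEdges] at h2
  -- `h2 : ρ̃ = shiftEdges δ ρ̃'`
  set δ := -(d + d + (xvec (T2 ext x') + -xvec (T2 ext x))) with hδ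
  have hρ'P := rho_isPolygon hx'
  have hρ'C := capHyp_rhoY hx'
  obtain ⟨hcap, hext⟩ := heqv (rho x') Y' δ hρ'P hρ'C
  have hlit : cap (rho x) Y = cap (shiftEdges δ (rho x')) (Y' + δ) := by rw [hcap]; exact h2
  have hT : T2 ext x = e + r + 1 := rfl
  have hT' : T2 ext x' = e' + r' + 1 := rfl
  have hδ1 : δ 1 = 0 := by simp [hδ, hd1]
  have hδ0 : δ 0 = -(d 0 + d 0 + (T2 ext x' - T2 ext x)) := by simp [hδ]; ring
  have hrow2 : Y 1 = (Y' + δ) 1 := by simp [hδ1, hrow]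
  have hcol2 : Y 0 + ext (rho x) Y = (Y' + δ) 0 + ext (shiftEdges δ (rho x')) (Y' + δ) := by
    rw [hext]; simp only [Pi.add_apply]; rw [hδ0, hd0, hT, hT', ← hr, ← hr']; linarith
  have hρ : rho x = shiftEdges δ (rho x') :=
    hinj (rho x) (shiftEdges δ (rho x')) Y (Y' + δ) (rho_isPolygon hx) (capHyp_rhoY hx)
      (isPolygon_shiftEdges hρ'P δ) (capHyp_shiftEdges.2 hρ'C) hrow2 hcol2 hlit
  -- un-turn: `sigS x` is a translate of `sigS x'` by a HORIZONTAL vector `μ`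
  rw [rho, rho, ← hY, ← hY', hYd, htEdges_center_add, shiftEdges_shiftEdges] at hρ
  have h3 := congrArg (htEdges Y) hρ
  rw [htEdges_htEdges, htEdges_shiftEdges, htEdges_htEdges] at h3
  set μ := -(d + d + δ) with hμ
  have hμ1 : μ 1 = 0 := by simp [hμ, hd1, hδ1]
  rw [sigS, sigS, slid, slid, hτ] at h3
  simp only [sigK, shiftEdges_shiftEdges] at h3
  have h4 := shift_cancel_left h3
  have hq0 := shift_eq_of_isNormal (h4 ▸ sig_isNormal hx) (by rw [shiftEdges_zero]; exact sig_isNormal hx')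
  refine ⟨by rw [h4, hq0, shiftEdges_zero], ?_⟩
  have := congrFun hq0 1
  simp [hμ1] at this
  linarith

/-- **`Ψ` is injective on `D_n`.** [cite: Madras1995LatticeAnimalsExponent, §2 (decoding the join); Hammond2015SAPJoining, §3.4, Step one, pp. 12–13 (arXiv v5)] -/
theorem Psi_injOn (hU : UniqueInteriorEqNeck) (hD : RayParityHoriz) :
    Set.InjOn (Psi cap ext) ↑(joinDom n) := by
  rintro ⟨⟨τ, σ⟩, k⟩ hx ⟨⟨τ', σ'⟩, k'⟩ hx' heq
  have hx : (⟨(τ, σ), k⟩ : JIdx) ∈ joinDom n := hx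
  have hx' : (⟨(τ', σ'), k'⟩ : JIdx) ∈ joinDom n := hx'
  obtain ⟨s, hJ⟩ := exists_shift_of_normalise_eq heq
  have hu := junction_shift hS hU hD hx hx' hJ
  obtain ⟨hτ, hσ⟩ := pieces_shift hS hx hx' hJ hu
  have hs : s = 0 := shift_eq_zero hS hx hx' hu hτ
  subst hs
  rw [add_zero] at hu
  rw [shiftEdges_zero] at hτ hσ hJ
  -- `τ' = τ`
  have hττ : τ' = τ := by
    obtain ⟨-, hinj, -⟩ := hS
    have hrow : Yx ⟨(τ', σ'), k'⟩ 1 = Yx ⟨(τ, σ), k⟩ 1 := by have := congrFun hu 1; simpa using this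
    have hcol := congrFun hu 0
    simp only [uJ_zero] at hcol
    exact hinj τ' τ _ _ (tau_isPolygon hx') (capHyp_tauY hx') (tau_isPolygon hx) (capHyp_tauY hx) hrow hcol hτ
  obtain ⟨hσσ, hkk⟩ := sigma_eq hS hx hx' hττ hu hσ
  simp only at hσσ hkk
  subst hττ hσσ hkk
  rfl

end Injectivity

/-! ### Assembly: `stub_joinMap` and `Counting2` -/

/-- **S4+S5 (the join map)** — for every `n`, an injective map from a domain of size `≥ ½ √n p_n²` into
`SAP_{2n+16}`; hypotheses S1a/S1b (domain size), S2 = `CapGadget` WITH the equivariance conjunct,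
S3⁺ = `UniqueInteriorEqNeck`, and (D1h) `RayParityHoriz` (a-p2's toolkit). [cite: Madras1995LatticeAnimalsExponent, §2; Hammond2015SAPJoining, §4.1 (arXiv v5)] -/
theorem stub_joinMap (hS1a : TallHalf) (hS1b : TallHeight) (hS2 : CapGadget) (hS3 : UniqueInteriorEqNeck)
    (hD : RayParityHoriz) (n : ℕ) : JoinMapSpec n := by
  obtain ⟨cap, ext, hS⟩ := hS2
  exact ⟨JIdx, joinDom n, Psi cap ext, card_joinDom_ge hS1a hS1b n, fun x hx => Psi_mem hS hx, Psi_injOn hS hS3 hD⟩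

/-- **`Counting2`**: S1a + S1b + S2 + S3⁺ ⇒ S5⁺ (`√n · p_n² ≤ 2 · p_{2n+16}` for even `n ≥ 4`), using the tree's (D1h)
`rayParityHoriz`. [cite: Madras1995LatticeAnimalsExponent, §2; Hammond2015SAPJoining, §4.1 pp. 17–20 and §3.4 pp. 12–13 (arXiv v5)] -/
theorem counting2 : Counting2 := fun hS1a hS1b hS2 hS3 =>
  joinIneq2_of_spec fun n _ _ => stub_joinMap hS1a hS1b hS2 hS3 rayParityHoriz n

/-- **S5⁺ from S1, S2, S3⁺** in the tree's current state: `JoinIneq2` holds as soon as `TallHalf`, `TallHeight` and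
`CapGadget` do (S3⁺ = `uniqueInteriorEqNeck` is a theorem). [cite: Madras1995LatticeAnimalsExponent, §2] -/
theorem joinIneq2_of (hS1a : TallHalf) (hS1b : TallHeight) (hS2 : CapGadget) : JoinIneq2 :=
  counting2 hS1a hS1b hS2 uniqueInteriorEqNeck

/-- **`Counting2`** (S1a → S1b → S2 → S3⁺ → the join inequality S5⁺), discharged under the exact `<Fact>_holds` name that
the tree's named-fact accounting keys on (the same proof as `counting2`).
[cite: Madras1995LatticeAnimalsExponent, §2; Hammond2015SAPJoining, §4.1 pp. 17–20 and §3.4 pp. 12–13 (arXiv v5)] -/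
theorem Counting2_holds : Counting2 := counting2

end Literature.Probability.RandomPlanarGeometry.SAW.JoinParity
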